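import Mathlib.LinearAlgebra.Dimension.Constructions
import Literature.NumberTheory.Transcendental.MultipleZetaValuesProofs
import Literature.NumberTheory.Transcendental.MultipleZetaHoffmanRelationProofs
import Literature.NumberTheory.Transcendental.MultipleZetaWeightFiveProofs
import Literature.NumberTheory.Transcendental.MZVWordShuffleProofs
import HarnessLib

/-!
# Multiple zeta values of weight `7`: `𝒵₇ = ℚ ζ(7) + ℚ π²ζ(5) + ℚ π⁴ζ(3)`

Sibling proof file of `Literature.NumberTheory.Transcendental.MultipleZeta` /
`…MultipleZetaValues` (theorems only: no definition, no statement change, no named fact),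
continuing `MultipleZetaWeightSixProofs.lean`. Weight `7` is the first weight with `d_n = 3`
(Hoffman indices `(3,2,2)`, `(2,3,2)`, `(2,2,3)`) and the first one not settled by Hoffman's 1992
computations; it needs the **shuffle product in depth `1 × 2`** (`MZVWordShuffleProofs.lean`):
an exact rank computation shows that duality, the harmonic products, the shuffles of two single
zeta values and all of Hoffman's relations (1992, Theorem 5.1) of weight `7` leave one relation
missing, which `ζ(2) ш ζ(2,3)` (or `ζ(3) ш ζ(2,2)`, …) supplies.

From the thirty-nine relations below — sixteen dualities (`MultipleZetaDuality.lean`), sixteen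
harmonic products `(2) ∗ t` (`|t| = 5`), `(3) ∗ t`, `(2,1) ∗ t` (`|t| = 4`) (`multipleZeta_mul`,
Hoffman 1997, Theorem 4.2) and seven shuffle products `(2) ш (5), (2) ш (4,1), (2) ш (3,2),
(2) ш (2,3), (3) ш (4), (3) ш (2,2), (3) ш (3,1)` (`multipleZeta_mul_eq_sum_map_shuffleWord`,
Eie 2013, §1.2), with the products evaluated through `ζ(2) = π²/6`, the weight-`4` values and the
weight-`5` table of `MultipleZetaWeightFiveProofs.lean` — all thirty-two multiple zeta values of
weight `7` are evaluated as rational combinations of `ζ(7)`, `π²ζ(5)`, `π⁴ζ(3)` (rank `31`), e.g.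
the classical `ζ(6,1) = 3ζ(7) - ζ(2)ζ(5) - ζ(3)ζ(4)` (Euler), `ζ(5,2) = -11ζ(7) + 5ζ(2)ζ(5) + 2ζ(3)ζ(4)`,
`ζ(4,3) = 17ζ(7) - 10ζ(2)ζ(5)` (Borwein–Bradley–Broadhurst; Chmutov–Duzhin–Mostovoy 2012, §10.2.6:
up to weight `12` every MZV is a rational polynomial in `ζ(2), ζ(3), ζ(5), ζ(7), …`). Hence
`mzvSpace_seven_eq_span : 𝒵₇ = ℚ ζ(7) + ℚ π²ζ(5) + ℚ π⁴ζ(3)`,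
`mzvSpace_seven_eq_span_hoffman : 𝒵₇ = ℚ ζ(3,2,2) + ℚ ζ(2,3,2) + ℚ ζ(2,2,3)` (Hoffman's
conjecture / Brown's theorem in weight `7`) and `finrank_mzvSpace_seven_le : dim_ℚ 𝒵₇ ≤ 3 = d₇`
(the Goncharov–Terasoma bound in weight `7`).

## References

* M. E. Hoffman, *The algebra of multiple harmonic series*, J. Algebra 194 (1997), 477–495,
  Theorem 4.2. [Hoffman1997]
* M. Eie, *The Theory of Multiple Zeta Values with Applications in Combinatorics*, World
  Scientific (2013), §1.2, Theorem 1.2.3. [Eie2013]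
* S. Chmutov, S. Duzhin, J. Mostovoy, *Introduction to Vassiliev Knot Invariants*, CUP (2012),
  §10.2.6. [ChmutovDuzhinMostovoy2012]
* M. E. Hoffman, *Multiple harmonic series*, Pacific J. Math. 152 (1992), 275–290, §5.
  [Hoffman1992]
-/

noncomputable section

namespace Literature.NumberTheory.Transcendental

/-! ### The duality relations of weight `7` -/

/-- Duality in weight `7`: `ζ(2,1,1,1,1,1) = ζ(7)`. [cite: Hoffman1992, §3 Duality conjecture p. 282] -/
theorem multipleZeta_two_one_one_one_one_one_eq_seven_dual : multipleZeta [2, 1, 1, 1, 1, 1] = multipleZeta [7] :=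
  multipleZeta_duality (by decide) (by decide) (by decide)

/-- Duality in weight `7`: `ζ(2,1,1,1,2) = ζ(2,5)`. [cite: Hoffman1992, §3 Duality conjecture p. 282] -/
theorem multipleZeta_two_one_one_one_two_eq_two_five_dual : multipleZeta [2, 1, 1, 1, 2] = multipleZeta [2, 5] :=
  multipleZeta_duality (by decide) (by decide) (by decide)

/-- Duality in weight `7`: `ζ(2,1,1,2,1) = ζ(3,4)`. [cite: Hoffman1992, §3 Duality conjecture p. 282] -/
theorem multipleZeta_two_one_one_two_one_eq_three_four_dual : multipleZeta [2, 1, 1, 2, 1] = multipleZeta [3, 4] :=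
  multipleZeta_duality (by decide) (by decide) (by decide)

/-- Duality in weight `7`: `ζ(2,1,1,3) = ζ(2,1,4)`. [cite: Hoffman1992, §3 Duality conjecture p. 282] -/
theorem multipleZeta_two_one_one_three_eq_two_one_four_dual : multipleZeta [2, 1, 1, 3] = multipleZeta [2, 1, 4] :=
  multipleZeta_duality (by decide) (by decide) (by decide)

/-- Duality in weight `7`: `ζ(2,1,2,1,1) = ζ(4,3)`. [cite: Hoffman1992, §3 Duality conjecture p. 282] -/
theorem multipleZeta_two_one_two_one_one_eq_four_three_dual : multipleZeta [2, 1, 2, 1, 1] = multipleZeta [4, 3] :=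
  multipleZeta_duality (by decide) (by decide) (by decide)

/-- Duality in weight `7`: `ζ(2,1,2,2) = ζ(2,2,3)`. [cite: Hoffman1992, §3 Duality conjecture p. 282] -/
theorem multipleZeta_two_one_two_two_eq_two_two_three_dual : multipleZeta [2, 1, 2, 2] = multipleZeta [2, 2, 3] :=
  multipleZeta_duality (by decide) (by decide) (by decide)

/-- Duality in weight `7`: `ζ(2,1,3,1) = ζ(3,1,3)`. [cite: Hoffman1992, §3 Duality conjecture p. 282] -/
theorem multipleZeta_two_one_three_one_eq_three_one_three_dual : multipleZeta [2, 1, 3, 1] = multipleZeta [3, 1, 3] :=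
  multipleZeta_duality (by decide) (by decide) (by decide)

/-- Duality in weight `7`: `ζ(2,2,1,1,1) = ζ(5,2)`. [cite: Hoffman1992, §3 Duality conjecture p. 282] -/
theorem multipleZeta_two_two_one_one_one_eq_five_two_dual : multipleZeta [2, 2, 1, 1, 1] = multipleZeta [5, 2] :=
  multipleZeta_duality (by decide) (by decide) (by decide)

/-- Duality in weight `7`: `ζ(2,2,1,2) = ζ(2,3,2)`. [cite: Hoffman1992, §3 Duality conjecture p. 282] -/
theorem multipleZeta_two_two_one_two_eq_two_three_two_dual : multipleZeta [2, 2, 1, 2] = multipleZeta [2, 3, 2] :=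
  multipleZeta_duality (by decide) (by decide) (by decide)

/-- Duality in weight `7`: `ζ(2,2,2,1) = ζ(3,2,2)`. [cite: Hoffman1992, §3 Duality conjecture p. 282] -/
theorem multipleZeta_two_two_two_one_eq_three_two_two_dual : multipleZeta [2, 2, 2, 1] = multipleZeta [3, 2, 2] :=
  multipleZeta_duality (by decide) (by decide) (by decide)

/-- Duality in weight `7`: `ζ(2,3,1,1) = ζ(4,1,2)`. [cite: Hoffman1992, §3 Duality conjecture p. 282] -/
theorem multipleZeta_two_three_one_one_eq_four_one_two_dual : multipleZeta [2, 3, 1, 1] = multipleZeta [4, 1, 2] :=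
  multipleZeta_duality (by decide) (by decide) (by decide)

/-- Duality in weight `7`: `ζ(2,4,1) = ζ(3,1,1,2)`. [cite: Hoffman1992, §3 Duality conjecture p. 282] -/
theorem multipleZeta_two_four_one_eq_three_one_one_two_dual : multipleZeta [2, 4, 1] = multipleZeta [3, 1, 1, 2] :=
  multipleZeta_duality (by decide) (by decide) (by decide)

/-- Duality in weight `7`: `ζ(3,1,1,1,1) = ζ(6,1)`. [cite: Hoffman1992, §3 Duality conjecture p. 282] -/
theorem multipleZeta_three_one_one_one_one_eq_six_one_dual : multipleZeta [3, 1, 1, 1, 1] = multipleZeta [6, 1] :=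
  multipleZeta_duality (by decide) (by decide) (by decide)

/-- Duality in weight `7`: `ζ(3,1,2,1) = ζ(3,3,1)`. [cite: Hoffman1992, §3 Duality conjecture p. 282] -/
theorem multipleZeta_three_one_two_one_eq_three_three_one_dual : multipleZeta [3, 1, 2, 1] = multipleZeta [3, 3, 1] :=
  multipleZeta_duality (by decide) (by decide) (by decide)

/-- Duality in weight `7`: `ζ(3,2,1,1) = ζ(4,2,1)`. [cite: Hoffman1992, §3 Duality conjecture p. 282] -/
theorem multipleZeta_three_two_one_one_eq_four_two_one_dual : multipleZeta [3, 2, 1, 1] = multipleZeta [4, 2, 1] :=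
  multipleZeta_duality (by decide) (by decide) (by decide)

/-- Duality in weight `7`: `ζ(4,1,1,1) = ζ(5,1,1)`. [cite: Hoffman1992, §3 Duality conjecture p. 282] -/
theorem multipleZeta_four_one_one_one_eq_five_one_one_dual : multipleZeta [4, 1, 1, 1] = multipleZeta [5, 1, 1] :=
  multipleZeta_duality (by decide) (by decide) (by decide)

/-! ### The harmonic and shuffle products of weight `7`, products evaluated -/

/-- `(2) ∗ (2,1,1,1)` with the product `ζ(2)ζ(2,1,1,1)` evaluated in `π²ζ(5)`, `π⁴ζ(3)`. [cite: Hoffman1997, Theorem 4.2] -/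
theorem stuffle_two_two_one_one_one_w7 :
    2 * multipleZeta [2, 2, 1, 1, 1] + multipleZeta [2, 1, 2, 1, 1] + multipleZeta [2, 1, 1, 2, 1] + multipleZeta [2, 1, 1, 1, 2] + multipleZeta [2, 1, 1, 3] + multipleZeta [2, 1, 3, 1] + multipleZeta [2, 3, 1, 1] + multipleZeta [4, 1, 1, 1] =
      1 / 6 * (Real.pi ^ 2 * multipleZeta [5]) := by
  have h : multipleZeta [2] * multipleZeta [2, 1, 1, 1] =
      2 * multipleZeta [2, 2, 1, 1, 1] + multipleZeta [2, 1, 2, 1, 1] + multipleZeta [2, 1, 1, 2, 1] + multipleZeta [2, 1, 1, 1, 2] + multipleZeta [2, 1, 1, 3] + multipleZeta [2, 1, 3, 1] + multipleZeta [2, 3, 1, 1] + multipleZeta [4, 1, 1, 1] := by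
    rw [multipleZeta_mul (by decide) (by decide),
      show MZV.stuffle [2] [2, 1, 1, 1] =
        [[2, 2, 1, 1, 1], [2, 2, 1, 1, 1], [2, 1, 2, 1, 1], [2, 1, 1, 2, 1], [2, 1, 1, 1, 2], [2, 1, 1, 3], [2, 1, 3, 1], [2, 3, 1, 1], [4, 1, 1, 1]] by simp [MZV.stuffle]]
    simp only [List.map_cons, List.map_nil, List.sum_cons, List.sum_nil]
    ring
  rw [← h, multipleZeta_two_one_one_one_eq_five, multipleZeta_two]
  ring

/-- `(2) ∗ (2,1,2)` with the product `ζ(2)ζ(2,1,2)` evaluated in `π²ζ(5)`, `π⁴ζ(3)`. [cite: Hoffman1997, Theorem 4.2] -/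
theorem stuffle_two_two_one_two_w7 :
    2 * multipleZeta [2, 2, 1, 2] + 2 * multipleZeta [2, 1, 2, 2] + multipleZeta [2, 1, 4] + multipleZeta [2, 3, 2] + multipleZeta [4, 1, 2] =
      3 / 4 * (Real.pi ^ 2 * multipleZeta [5]) - 1 / 18 * (Real.pi ^ 4 * multipleZeta [3]) := by
  have h : multipleZeta [2] * multipleZeta [2, 1, 2] =
      2 * multipleZeta [2, 2, 1, 2] + 2 * multipleZeta [2, 1, 2, 2] + multipleZeta [2, 1, 4] + multipleZeta [2, 3, 2] + multipleZeta [4, 1, 2] := by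
    rw [multipleZeta_mul (by decide) (by decide),
      show MZV.stuffle [2] [2, 1, 2] =
        [[2, 2, 1, 2], [2, 2, 1, 2], [2, 1, 2, 2], [2, 1, 2, 2], [2, 1, 4], [2, 3, 2], [4, 1, 2]] by simp [MZV.stuffle]]
    simp only [List.map_cons, List.map_nil, List.sum_cons, List.sum_nil]
    ring
  rw [← h, multipleZeta_two_one_two_eq_two_three, multipleZeta_two_three_eq, multipleZeta_two]
  ring

/-- `(2) ∗ (2,2,1)` with the product `ζ(2)ζ(2,2,1)` evaluated in `π²ζ(5)`, `π⁴ζ(3)`. [cite: Hoffman1997, Theorem 4.2] -/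
theorem stuffle_two_two_two_one_w7 :
    3 * multipleZeta [2, 2, 2, 1] + multipleZeta [2, 2, 1, 2] + multipleZeta [2, 2, 3] + multipleZeta [2, 4, 1] + multipleZeta [4, 2, 1] =
      -(11 / 12 * (Real.pi ^ 2 * multipleZeta [5])) + 1 / 12 * (Real.pi ^ 4 * multipleZeta [3]) := by
  have h : multipleZeta [2] * multipleZeta [2, 2, 1] =
      3 * multipleZeta [2, 2, 2, 1] + multipleZeta [2, 2, 1, 2] + multipleZeta [2, 2, 3] + multipleZeta [2, 4, 1] + multipleZeta [4, 2, 1] := by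
    rw [multipleZeta_mul (by decide) (by decide),
      show MZV.stuffle [2] [2, 2, 1] =
        [[2, 2, 2, 1], [2, 2, 2, 1], [2, 2, 2, 1], [2, 2, 1, 2], [2, 2, 3], [2, 4, 1], [4, 2, 1]] by simp [MZV.stuffle]]
    simp only [List.map_cons, List.map_nil, List.sum_cons, List.sum_nil]
    ring
  rw [← h, multipleZeta_two_two_one_eq_three_two, multipleZeta_three_two_eq, multipleZeta_two]
  ring

/-- `(2) ∗ (2,3)` with the product `ζ(2)ζ(2,3)` evaluated in `π²ζ(5)`, `π⁴ζ(3)`. [cite: Hoffman1997, Theorem 4.2] -/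
theorem stuffle_two_two_three_w7 :
    2 * multipleZeta [2, 2, 3] + multipleZeta [2, 3, 2] + multipleZeta [2, 5] + multipleZeta [4, 3] =
      3 / 4 * (Real.pi ^ 2 * multipleZeta [5]) - 1 / 18 * (Real.pi ^ 4 * multipleZeta [3]) := by
  have h : multipleZeta [2] * multipleZeta [2, 3] =
      2 * multipleZeta [2, 2, 3] + multipleZeta [2, 3, 2] + multipleZeta [2, 5] + multipleZeta [4, 3] := by
    rw [multipleZeta_mul (by decide) (by decide),
      show MZV.stuffle [2] [2, 3] =
        [[2, 2, 3], [2, 2, 3], [2, 3, 2], [2, 5], [4, 3]] by simp [MZV.stuffle]]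
    simp only [List.map_cons, List.map_nil, List.sum_cons, List.sum_nil]
    ring
  rw [← h, multipleZeta_two_three_eq, multipleZeta_two]
  ring

/-- `(2) ∗ (3,1,1)` with the product `ζ(2)ζ(3,1,1)` evaluated in `π²ζ(5)`, `π⁴ζ(3)`. [cite: Hoffman1997, Theorem 4.2] -/
theorem stuffle_two_three_one_one_w7 :
    multipleZeta [2, 3, 1, 1] + multipleZeta [3, 2, 1, 1] + multipleZeta [3, 1, 2, 1] + multipleZeta [3, 1, 1, 2] + multipleZeta [3, 1, 3] + multipleZeta [3, 3, 1] + multipleZeta [5, 1, 1] =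
      1 / 3 * (Real.pi ^ 2 * multipleZeta [5]) - 1 / 36 * (Real.pi ^ 4 * multipleZeta [3]) := by
  have h : multipleZeta [2] * multipleZeta [3, 1, 1] =
      multipleZeta [2, 3, 1, 1] + multipleZeta [3, 2, 1, 1] + multipleZeta [3, 1, 2, 1] + multipleZeta [3, 1, 1, 2] + multipleZeta [3, 1, 3] + multipleZeta [3, 3, 1] + multipleZeta [5, 1, 1] := by
    rw [multipleZeta_mul (by decide) (by decide),
      show MZV.stuffle [2] [3, 1, 1] =
        [[2, 3, 1, 1], [3, 2, 1, 1], [3, 1, 2, 1], [3, 1, 1, 2], [3, 1, 3], [3, 3, 1], [5, 1, 1]] by simp [MZV.stuffle]]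
    simp only [List.map_cons, List.map_nil, List.sum_cons, List.sum_nil]
    ring
  rw [← h, multipleZeta_three_one_one_eq_four_one, multipleZeta_four_one_eq, multipleZeta_two]
  ring

/-- `(2) ∗ (3,2)` with the product `ζ(2)ζ(3,2)` evaluated in `π²ζ(5)`, `π⁴ζ(3)`. [cite: Hoffman1997, Theorem 4.2] -/
theorem stuffle_two_three_two_w7 :
    multipleZeta [2, 3, 2] + 2 * multipleZeta [3, 2, 2] + multipleZeta [3, 4] + multipleZeta [5, 2] =
      -(11 / 12 * (Real.pi ^ 2 * multipleZeta [5])) + 1 / 12 * (Real.pi ^ 4 * multipleZeta [3]) := by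
  have h : multipleZeta [2] * multipleZeta [3, 2] =
      multipleZeta [2, 3, 2] + 2 * multipleZeta [3, 2, 2] + multipleZeta [3, 4] + multipleZeta [5, 2] := by
    rw [multipleZeta_mul (by decide) (by decide),
      show MZV.stuffle [2] [3, 2] =
        [[2, 3, 2], [3, 2, 2], [3, 2, 2], [3, 4], [5, 2]] by simp [MZV.stuffle]]
    simp only [List.map_cons, List.map_nil, List.sum_cons, List.sum_nil]
    ring
  rw [← h, multipleZeta_three_two_eq, multipleZeta_two]
  ring

/-- `(2) ∗ (4,1)` with the product `ζ(2)ζ(4,1)` evaluated in `π²ζ(5)`, `π⁴ζ(3)`. [cite: Hoffman1997, Theorem 4.2] -/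
theorem stuffle_two_four_one_w7 :
    multipleZeta [2, 4, 1] + multipleZeta [4, 2, 1] + multipleZeta [4, 1, 2] + multipleZeta [4, 3] + multipleZeta [6, 1] =
      1 / 3 * (Real.pi ^ 2 * multipleZeta [5]) - 1 / 36 * (Real.pi ^ 4 * multipleZeta [3]) := by
  have h : multipleZeta [2] * multipleZeta [4, 1] =
      multipleZeta [2, 4, 1] + multipleZeta [4, 2, 1] + multipleZeta [4, 1, 2] + multipleZeta [4, 3] + multipleZeta [6, 1] := by
    rw [multipleZeta_mul (by decide) (by decide),
      show MZV.stuffle [2] [4, 1] =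
        [[2, 4, 1], [4, 2, 1], [4, 1, 2], [4, 3], [6, 1]] by simp [MZV.stuffle]]
    simp only [List.map_cons, List.map_nil, List.sum_cons, List.sum_nil]
    ring
  rw [← h, multipleZeta_four_one_eq, multipleZeta_two]
  ring

/-- `(2) ∗ (5)` with the product `ζ(2)ζ(5)` evaluated in `π²ζ(5)`, `π⁴ζ(3)`. [cite: Hoffman1997, Theorem 4.2] -/
theorem stuffle_two_five_w7 :
    multipleZeta [2, 5] + multipleZeta [5, 2] + multipleZeta [7] =
      1 / 6 * (Real.pi ^ 2 * multipleZeta [5]) := by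
  have h : multipleZeta [2] * multipleZeta [5] =
      multipleZeta [2, 5] + multipleZeta [5, 2] + multipleZeta [7] := by
    rw [multipleZeta_mul (by decide) (by decide),
      show MZV.stuffle [2] [5] =
        [[2, 5], [5, 2], [7]] by simp [MZV.stuffle]]
    simp only [List.map_cons, List.map_nil, List.sum_cons, List.sum_nil]
    ring
  rw [← h, multipleZeta_two]
  ring

/-- `(3) ∗ (2,1,1)` with the product `ζ(3)ζ(2,1,1)` evaluated in `π²ζ(5)`, `π⁴ζ(3)`. [cite: Hoffman1997, Theorem 4.2] -/
theorem stuffle_three_two_one_one_w7 :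
    multipleZeta [3, 2, 1, 1] + multipleZeta [2, 3, 1, 1] + multipleZeta [2, 1, 3, 1] + multipleZeta [2, 1, 1, 3] + multipleZeta [2, 1, 4] + multipleZeta [2, 4, 1] + multipleZeta [5, 1, 1] =
      1 / 90 * (Real.pi ^ 4 * multipleZeta [3]) := by
  have h : multipleZeta [3] * multipleZeta [2, 1, 1] =
      multipleZeta [3, 2, 1, 1] + multipleZeta [2, 3, 1, 1] + multipleZeta [2, 1, 3, 1] + multipleZeta [2, 1, 1, 3] + multipleZeta [2, 1, 4] + multipleZeta [2, 4, 1] + multipleZeta [5, 1, 1] := by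
    rw [multipleZeta_mul (by decide) (by decide),
      show MZV.stuffle [3] [2, 1, 1] =
        [[3, 2, 1, 1], [2, 3, 1, 1], [2, 1, 3, 1], [2, 1, 1, 3], [2, 1, 4], [2, 4, 1], [5, 1, 1]] by simp [MZV.stuffle]]
    simp only [List.map_cons, List.map_nil, List.sum_cons, List.sum_nil]
    ring
  rw [← h, multipleZeta_two_one_one]
  ring

/-- `(3) ∗ (2,2)` with the product `ζ(3)ζ(2,2)` evaluated in `π²ζ(5)`, `π⁴ζ(3)`. [cite: Hoffman1997, Theorem 4.2] -/
theorem stuffle_three_two_two_w7 :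
    multipleZeta [3, 2, 2] + multipleZeta [2, 3, 2] + multipleZeta [2, 2, 3] + multipleZeta [2, 5] + multipleZeta [5, 2] =
      1 / 120 * (Real.pi ^ 4 * multipleZeta [3]) := by
  have h : multipleZeta [3] * multipleZeta [2, 2] =
      multipleZeta [3, 2, 2] + multipleZeta [2, 3, 2] + multipleZeta [2, 2, 3] + multipleZeta [2, 5] + multipleZeta [5, 2] := by
    rw [multipleZeta_mul (by decide) (by decide),
      show MZV.stuffle [3] [2, 2] =
        [[3, 2, 2], [2, 3, 2], [2, 2, 3], [2, 5], [5, 2]] by simp [MZV.stuffle]]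
    simp only [List.map_cons, List.map_nil, List.sum_cons, List.sum_nil]
    ring
  rw [← h, multipleZeta_two_two]
  ring

/-- `(3) ∗ (3,1)` with the product `ζ(3)ζ(3,1)` evaluated in `π²ζ(5)`, `π⁴ζ(3)`. [cite: Hoffman1997, Theorem 4.2] -/
theorem stuffle_three_three_one_w7 :
    2 * multipleZeta [3, 3, 1] + multipleZeta [3, 1, 3] + multipleZeta [3, 4] + multipleZeta [6, 1] =
      1 / 360 * (Real.pi ^ 4 * multipleZeta [3]) := by
  have h : multipleZeta [3] * multipleZeta [3, 1] =
      2 * multipleZeta [3, 3, 1] + multipleZeta [3, 1, 3] + multipleZeta [3, 4] + multipleZeta [6, 1] := by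
    rw [multipleZeta_mul (by decide) (by decide),
      show MZV.stuffle [3] [3, 1] =
        [[3, 3, 1], [3, 3, 1], [3, 1, 3], [3, 4], [6, 1]] by simp [MZV.stuffle]]
    simp only [List.map_cons, List.map_nil, List.sum_cons, List.sum_nil]
    ring
  rw [← h, multipleZeta_three_one]
  ring

/-- `(3) ∗ (4)` with the product `ζ(3)ζ(4)` evaluated in `π²ζ(5)`, `π⁴ζ(3)`. [cite: Hoffman1997, Theorem 4.2] -/
theorem stuffle_three_four_w7 :
    multipleZeta [3, 4] + multipleZeta [4, 3] + multipleZeta [7] =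
      1 / 90 * (Real.pi ^ 4 * multipleZeta [3]) := by
  have h : multipleZeta [3] * multipleZeta [4] =
      multipleZeta [3, 4] + multipleZeta [4, 3] + multipleZeta [7] := by
    rw [multipleZeta_mul (by decide) (by decide),
      show MZV.stuffle [3] [4] =
        [[3, 4], [4, 3], [7]] by simp [MZV.stuffle]]
    simp only [List.map_cons, List.map_nil, List.sum_cons, List.sum_nil]
    ring
  rw [← h, multipleZeta_four]
  ring

/-- `(2,1) ∗ (2,1,1)` with the product `ζ(2,1)ζ(2,1,1)` evaluated in `π²ζ(5)`, `π⁴ζ(3)`. [cite: Hoffman1997, Theorem 4.2] -/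
theorem stuffle_two_one_two_one_one_w7 :
    3 * multipleZeta [2, 1, 2, 1, 1] + 6 * multipleZeta [2, 2, 1, 1, 1] + 2 * multipleZeta [2, 2, 1, 2] + 2 * multipleZeta [2, 2, 2, 1] + 3 * multipleZeta [2, 3, 1, 1] + multipleZeta [2, 1, 2, 2] + multipleZeta [2, 1, 1, 2, 1] + multipleZeta [2, 1, 3, 1] + multipleZeta [2, 3, 2] + 3 * multipleZeta [4, 1, 1, 1] + multipleZeta [4, 1, 2] + multipleZeta [4, 2, 1] =
      1 / 90 * (Real.pi ^ 4 * multipleZeta [3]) := by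
  have h : multipleZeta [2, 1] * multipleZeta [2, 1, 1] =
      3 * multipleZeta [2, 1, 2, 1, 1] + 6 * multipleZeta [2, 2, 1, 1, 1] + 2 * multipleZeta [2, 2, 1, 2] + 2 * multipleZeta [2, 2, 2, 1] + 3 * multipleZeta [2, 3, 1, 1] + multipleZeta [2, 1, 2, 2] + multipleZeta [2, 1, 1, 2, 1] + multipleZeta [2, 1, 3, 1] + multipleZeta [2, 3, 2] + 3 * multipleZeta [4, 1, 1, 1] + multipleZeta [4, 1, 2] + multipleZeta [4, 2, 1] := by
    rw [multipleZeta_mul (by decide) (by decide),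
      show MZV.stuffle [2, 1] [2, 1, 1] =
        [[2, 1, 2, 1, 1], [2, 2, 1, 1, 1], [2, 2, 1, 1, 1], [2, 2, 1, 1, 1], [2, 2, 1, 2], [2, 2, 2, 1], [2, 3, 1, 1], [2, 2, 1, 1, 1], [2, 2, 1, 1, 1], [2, 2, 1, 1, 1], [2, 2, 1, 2], [2, 2, 2, 1], [2, 1, 2, 1, 1], [2, 1, 2, 1, 1], [2, 1, 2, 2], [2, 1, 1, 2, 1], [2, 1, 3, 1], [2, 3, 1, 1], [2, 3, 1, 1], [2, 3, 2], [4, 1, 1, 1], [4, 1, 1, 1], [4, 1, 1, 1], [4, 1, 2], [4, 2, 1]] by simp [MZV.stuffle]]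
    simp only [List.map_cons, List.map_nil, List.sum_cons, List.sum_nil]
    ring
  rw [← h, show multipleZeta [2, 1] = multipleZeta [3] from euler_zeta_two_one_holds, multipleZeta_two_one_one]
  ring

/-- `(2,1) ∗ (2,2)` with the product `ζ(2,1)ζ(2,2)` evaluated in `π²ζ(5)`, `π⁴ζ(3)`. [cite: Hoffman1997, Theorem 4.2] -/
theorem stuffle_two_one_two_two_w7 :
    multipleZeta [2, 1, 2, 2] + 2 * multipleZeta [2, 2, 1, 2] + 3 * multipleZeta [2, 2, 2, 1] + 2 * multipleZeta [2, 2, 3] + multipleZeta [2, 3, 2] + multipleZeta [2, 4, 1] + multipleZeta [4, 1, 2] + multipleZeta [4, 2, 1] + multipleZeta [4, 3] =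
      1 / 120 * (Real.pi ^ 4 * multipleZeta [3]) := by
  have h : multipleZeta [2, 1] * multipleZeta [2, 2] =
      multipleZeta [2, 1, 2, 2] + 2 * multipleZeta [2, 2, 1, 2] + 3 * multipleZeta [2, 2, 2, 1] + 2 * multipleZeta [2, 2, 3] + multipleZeta [2, 3, 2] + multipleZeta [2, 4, 1] + multipleZeta [4, 1, 2] + multipleZeta [4, 2, 1] + multipleZeta [4, 3] := by
    rw [multipleZeta_mul (by decide) (by decide),
      show MZV.stuffle [2, 1] [2, 2] =
        [[2, 1, 2, 2], [2, 2, 1, 2], [2, 2, 2, 1], [2, 2, 3], [2, 3, 2], [2, 2, 1, 2], [2, 2, 2, 1], [2, 2, 3], [2, 2, 2, 1], [2, 4, 1], [4, 1, 2], [4, 2, 1], [4, 3]] by simp [MZV.stuffle]]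
    simp only [List.map_cons, List.map_nil, List.sum_cons, List.sum_nil]
    ring
  rw [← h, show multipleZeta [2, 1] = multipleZeta [3] from euler_zeta_two_one_holds, multipleZeta_two_two]
  ring

/-- `(2,1) ∗ (3,1)` with the product `ζ(2,1)ζ(3,1)` evaluated in `π²ζ(5)`, `π⁴ζ(3)`. [cite: Hoffman1997, Theorem 4.2] -/
theorem stuffle_two_one_three_one_w7 :
    multipleZeta [2, 1, 3, 1] + 2 * multipleZeta [2, 3, 1, 1] + multipleZeta [2, 3, 2] + multipleZeta [2, 4, 1] + 2 * multipleZeta [3, 2, 1, 1] + multipleZeta [3, 2, 2] + multipleZeta [3, 1, 2, 1] + multipleZeta [3, 3, 1] + 2 * multipleZeta [5, 1, 1] + multipleZeta [5, 2] =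
      1 / 360 * (Real.pi ^ 4 * multipleZeta [3]) := by
  have h : multipleZeta [2, 1] * multipleZeta [3, 1] =
      multipleZeta [2, 1, 3, 1] + 2 * multipleZeta [2, 3, 1, 1] + multipleZeta [2, 3, 2] + multipleZeta [2, 4, 1] + 2 * multipleZeta [3, 2, 1, 1] + multipleZeta [3, 2, 2] + multipleZeta [3, 1, 2, 1] + multipleZeta [3, 3, 1] + 2 * multipleZeta [5, 1, 1] + multipleZeta [5, 2] := by
    rw [multipleZeta_mul (by decide) (by decide),
      show MZV.stuffle [2, 1] [3, 1] =
        [[2, 1, 3, 1], [2, 3, 1, 1], [2, 3, 1, 1], [2, 3, 2], [2, 4, 1], [3, 2, 1, 1], [3, 2, 1, 1], [3, 2, 2], [3, 1, 2, 1], [3, 3, 1], [5, 1, 1], [5, 1, 1], [5, 2]] by simp [MZV.stuffle]]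
    simp only [List.map_cons, List.map_nil, List.sum_cons, List.sum_nil]
    ring
  rw [← h, show multipleZeta [2, 1] = multipleZeta [3] from euler_zeta_two_one_holds, multipleZeta_three_one]
  ring

/-- `(2,1) ∗ (4)` with the product `ζ(2,1)ζ(4)` evaluated in `π²ζ(5)`, `π⁴ζ(3)`. [cite: Hoffman1997, Theorem 4.2] -/
theorem stuffle_two_one_four_w7 :
    multipleZeta [2, 1, 4] + multipleZeta [2, 4, 1] + multipleZeta [2, 5] + multipleZeta [4, 2, 1] + multipleZeta [6, 1] =
      1 / 90 * (Real.pi ^ 4 * multipleZeta [3]) := by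
  have h : multipleZeta [2, 1] * multipleZeta [4] =
      multipleZeta [2, 1, 4] + multipleZeta [2, 4, 1] + multipleZeta [2, 5] + multipleZeta [4, 2, 1] + multipleZeta [6, 1] := by
    rw [multipleZeta_mul (by decide) (by decide),
      show MZV.stuffle [2, 1] [4] =
        [[2, 1, 4], [2, 4, 1], [2, 5], [4, 2, 1], [6, 1]] by simp [MZV.stuffle]]
    simp only [List.map_cons, List.map_nil, List.sum_cons, List.sum_nil]
    ring
  rw [← h, show multipleZeta [2, 1] = multipleZeta [3] from euler_zeta_two_one_holds, multipleZeta_four]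
  ring

/-- `(2) ш (5)` with the product `ζ(2)ζ(5)` evaluated in `π²ζ(5)`, `π⁴ζ(3)`. [cite: Eie2013, §1.2] -/
theorem shuffle_two_five_w7 :
    multipleZeta [2, 5] + 2 * multipleZeta [3, 4] + 3 * multipleZeta [4, 3] + 5 * multipleZeta [5, 2] + 10 * multipleZeta [6, 1] =
      1 / 6 * (Real.pi ^ 2 * multipleZeta [5]) := by
  have h : multipleZeta [2] * multipleZeta [5] =
      multipleZeta [2, 5] + 2 * multipleZeta [3, 4] + 3 * multipleZeta [4, 3] + 5 * multipleZeta [5, 2] + 10 * multipleZeta [6, 1] := by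
    rw [multipleZeta_mul_eq_sum_map_shuffleWord (by decide) (by decide),
      show ((MZV.shuffleWord (MZV.binaryWord [2]) (MZV.binaryWord [5])).map
          MZV.ofBinaryWord) = [[2, 5], [3, 4], [4, 3], [5, 2], [6, 1], [6, 1], [3, 4], [4, 3], [5, 2], [6, 1], [6, 1], [4, 3], [5, 2], [6, 1], [6, 1], [5, 2], [6, 1], [6, 1], [6, 1], [6, 1], [5, 2]] by decide]
    simp only [List.map_cons, List.map_nil, List.sum_cons, List.sum_nil]
    ring
  rw [← h, multipleZeta_two]
  ring

/-- `(2) ш (4,1)` with the product `ζ(2)ζ(4,1)` evaluated in `π²ζ(5)`, `π⁴ζ(3)`. [cite: Eie2013, §1.2] -/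
theorem shuffle_two_four_one_w7 :
    multipleZeta [2, 4, 1] + 2 * multipleZeta [3, 3, 1] + 5 * multipleZeta [4, 2, 1] + 12 * multipleZeta [5, 1, 1] + multipleZeta [4, 1, 2] =
      1 / 3 * (Real.pi ^ 2 * multipleZeta [5]) - 1 / 36 * (Real.pi ^ 4 * multipleZeta [3]) := by
  have h : multipleZeta [2] * multipleZeta [4, 1] =
      multipleZeta [2, 4, 1] + 2 * multipleZeta [3, 3, 1] + 5 * multipleZeta [4, 2, 1] + 12 * multipleZeta [5, 1, 1] + multipleZeta [4, 1, 2] := by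
    rw [multipleZeta_mul_eq_sum_map_shuffleWord (by decide) (by decide),
      show ((MZV.shuffleWord (MZV.binaryWord [2]) (MZV.binaryWord [4, 1])).map
          MZV.ofBinaryWord) = [[2, 4, 1], [3, 3, 1], [4, 2, 1], [5, 1, 1], [5, 1, 1], [5, 1, 1], [3, 3, 1], [4, 2, 1], [5, 1, 1], [5, 1, 1], [5, 1, 1], [4, 2, 1], [5, 1, 1], [5, 1, 1], [5, 1, 1], [5, 1, 1], [5, 1, 1], [5, 1, 1], [4, 2, 1], [4, 2, 1], [4, 1, 2]] by decide]
    simp only [List.map_cons, List.map_nil, List.sum_cons, List.sum_nil]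
    ring
  rw [← h, multipleZeta_four_one_eq, multipleZeta_two]
  ring

/-- `(2) ш (3,2)` with the product `ζ(2)ζ(3,2)` evaluated in `π²ζ(5)`, `π⁴ζ(3)`. [cite: Eie2013, §1.2] -/
theorem shuffle_two_three_two_w7 :
    multipleZeta [2, 3, 2] + 4 * multipleZeta [3, 2, 2] + 6 * multipleZeta [4, 1, 2] + 6 * multipleZeta [4, 2, 1] + 4 * multipleZeta [3, 3, 1] =
      -(11 / 12 * (Real.pi ^ 2 * multipleZeta [5])) + 1 / 12 * (Real.pi ^ 4 * multipleZeta [3]) := by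
  have h : multipleZeta [2] * multipleZeta [3, 2] =
      multipleZeta [2, 3, 2] + 4 * multipleZeta [3, 2, 2] + 6 * multipleZeta [4, 1, 2] + 6 * multipleZeta [4, 2, 1] + 4 * multipleZeta [3, 3, 1] := by
    rw [multipleZeta_mul_eq_sum_map_shuffleWord (by decide) (by decide),
      show ((MZV.shuffleWord (MZV.binaryWord [2]) (MZV.binaryWord [3, 2])).map
          MZV.ofBinaryWord) = [[2, 3, 2], [3, 2, 2], [4, 1, 2], [4, 1, 2], [4, 2, 1], [4, 2, 1], [3, 2, 2], [4, 1, 2], [4, 1, 2], [4, 2, 1], [4, 2, 1], [4, 1, 2], [4, 1, 2], [4, 2, 1], [4, 2, 1], [3, 2, 2], [3, 3, 1], [3, 3, 1], [3, 3, 1], [3, 3, 1], [3, 2, 2]] by decide]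
    simp only [List.map_cons, List.map_nil, List.sum_cons, List.sum_nil]
    ring
  rw [← h, multipleZeta_three_two_eq, multipleZeta_two]
  ring

/-- `(2) ш (2,3)` with the product `ζ(2)ζ(2,3)` evaluated in `π²ζ(5)`, `π⁴ζ(3)`. [cite: Eie2013, §1.2] -/
theorem shuffle_two_two_three_w7 :
    2 * multipleZeta [2, 2, 3] + 4 * multipleZeta [3, 1, 3] + 2 * multipleZeta [3, 2, 2] + 4 * multipleZeta [3, 3, 1] + 3 * multipleZeta [2, 3, 2] + 6 * multipleZeta [2, 4, 1] =
      3 / 4 * (Real.pi ^ 2 * multipleZeta [5]) - 1 / 18 * (Real.pi ^ 4 * multipleZeta [3]) := by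
  have h : multipleZeta [2] * multipleZeta [2, 3] =
      2 * multipleZeta [2, 2, 3] + 4 * multipleZeta [3, 1, 3] + 2 * multipleZeta [3, 2, 2] + 4 * multipleZeta [3, 3, 1] + 3 * multipleZeta [2, 3, 2] + 6 * multipleZeta [2, 4, 1] := by
    rw [multipleZeta_mul_eq_sum_map_shuffleWord (by decide) (by decide),
      show ((MZV.shuffleWord (MZV.binaryWord [2]) (MZV.binaryWord [2, 3])).map
          MZV.ofBinaryWord) = [[2, 2, 3], [3, 1, 3], [3, 1, 3], [3, 2, 2], [3, 3, 1], [3, 3, 1], [3, 1, 3], [3, 1, 3], [3, 2, 2], [3, 3, 1], [3, 3, 1], [2, 2, 3], [2, 3, 2], [2, 4, 1], [2, 4, 1], [2, 3, 2], [2, 4, 1], [2, 4, 1], [2, 4, 1], [2, 4, 1], [2, 3, 2]] by decide]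
    simp only [List.map_cons, List.map_nil, List.sum_cons, List.sum_nil]
    ring
  rw [← h, multipleZeta_two_three_eq, multipleZeta_two]
  ring

/-- `(3) ш (4)` with the product `ζ(3)ζ(4)` evaluated in `π²ζ(5)`, `π⁴ζ(3)`. [cite: Eie2013, §1.2] -/
theorem shuffle_three_four_w7 :
    multipleZeta [3, 4] + 4 * multipleZeta [4, 3] + 10 * multipleZeta [5, 2] + 20 * multipleZeta [6, 1] =
      1 / 90 * (Real.pi ^ 4 * multipleZeta [3]) := by
  have h : multipleZeta [3] * multipleZeta [4] =
      multipleZeta [3, 4] + 4 * multipleZeta [4, 3] + 10 * multipleZeta [5, 2] + 20 * multipleZeta [6, 1] := by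
    rw [multipleZeta_mul_eq_sum_map_shuffleWord (by decide) (by decide),
      show ((MZV.shuffleWord (MZV.binaryWord [3]) (MZV.binaryWord [4])).map
          MZV.ofBinaryWord) = [[3, 4], [4, 3], [5, 2], [6, 1], [6, 1], [4, 3], [5, 2], [6, 1], [6, 1], [5, 2], [6, 1], [6, 1], [6, 1], [6, 1], [5, 2], [4, 3], [5, 2], [6, 1], [6, 1], [5, 2], [6, 1], [6, 1], [6, 1], [6, 1], [5, 2], [5, 2], [6, 1], [6, 1], [6, 1], [6, 1], [5, 2], [6, 1], [6, 1], [5, 2], [4, 3]] by decide]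
    simp only [List.map_cons, List.map_nil, List.sum_cons, List.sum_nil]
    ring
  rw [← h, multipleZeta_four]
  ring

/-- `(3) ш (2,2)` with the product `ζ(3)ζ(2,2)` evaluated in `π²ζ(5)`, `π⁴ζ(3)`. [cite: Eie2013, §1.2] -/
theorem shuffle_three_two_two_w7 :
    5 * multipleZeta [3, 2, 2] + 6 * multipleZeta [4, 1, 2] + 6 * multipleZeta [4, 2, 1] + 8 * multipleZeta [3, 3, 1] + 3 * multipleZeta [2, 3, 2] + 6 * multipleZeta [2, 4, 1] + multipleZeta [2, 2, 3] =
      1 / 120 * (Real.pi ^ 4 * multipleZeta [3]) := by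
  have h : multipleZeta [3] * multipleZeta [2, 2] =
      5 * multipleZeta [3, 2, 2] + 6 * multipleZeta [4, 1, 2] + 6 * multipleZeta [4, 2, 1] + 8 * multipleZeta [3, 3, 1] + 3 * multipleZeta [2, 3, 2] + 6 * multipleZeta [2, 4, 1] + multipleZeta [2, 2, 3] := by
    rw [multipleZeta_mul_eq_sum_map_shuffleWord (by decide) (by decide),
      show ((MZV.shuffleWord (MZV.binaryWord [3]) (MZV.binaryWord [2, 2])).map
          MZV.ofBinaryWord) = [[3, 2, 2], [4, 1, 2], [4, 1, 2], [4, 2, 1], [4, 2, 1], [4, 1, 2], [4, 1, 2], [4, 2, 1], [4, 2, 1], [3, 2, 2], [3, 3, 1], [3, 3, 1], [3, 3, 1], [3, 3, 1], [3, 2, 2], [4, 1, 2], [4, 1, 2], [4, 2, 1], [4, 2, 1], [3, 2, 2], [3, 3, 1], [3, 3, 1], [3, 3, 1], [3, 3, 1], [3, 2, 2], [2, 3, 2], [2, 4, 1], [2, 4, 1], [2, 4, 1], [2, 4, 1], [2, 3, 2], [2, 4, 1], [2, 4, 1], [2, 3, 2], [2, 2, 3]] by decide]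
    simp only [List.map_cons, List.map_nil, List.sum_cons, List.sum_nil]
    ring
  rw [← h, multipleZeta_two_two]
  ring

/-- `(3) ш (3,1)` with the product `ζ(3)ζ(3,1)` evaluated in `π²ζ(5)`, `π⁴ζ(3)`. [cite: Eie2013, §1.2] -/
theorem shuffle_three_three_one_w7 :
    3 * multipleZeta [3, 3, 1] + 9 * multipleZeta [4, 2, 1] + 18 * multipleZeta [5, 1, 1] + 3 * multipleZeta [4, 1, 2] + multipleZeta [3, 2, 2] + multipleZeta [3, 1, 3] =
      1 / 360 * (Real.pi ^ 4 * multipleZeta [3]) := by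
  have h : multipleZeta [3] * multipleZeta [3, 1] =
      3 * multipleZeta [3, 3, 1] + 9 * multipleZeta [4, 2, 1] + 18 * multipleZeta [5, 1, 1] + 3 * multipleZeta [4, 1, 2] + multipleZeta [3, 2, 2] + multipleZeta [3, 1, 3] := by
    rw [multipleZeta_mul_eq_sum_map_shuffleWord (by decide) (by decide),
      show ((MZV.shuffleWord (MZV.binaryWord [3]) (MZV.binaryWord [3, 1])).map
          MZV.ofBinaryWord) = [[3, 3, 1], [4, 2, 1], [5, 1, 1], [5, 1, 1], [5, 1, 1], [4, 2, 1], [5, 1, 1], [5, 1, 1], [5, 1, 1], [5, 1, 1], [5, 1, 1], [5, 1, 1], [4, 2, 1], [4, 2, 1], [4, 1, 2], [4, 2, 1], [5, 1, 1], [5, 1, 1], [5, 1, 1], [5, 1, 1], [5, 1, 1], [5, 1, 1], [4, 2, 1], [4, 2, 1], [4, 1, 2], [5, 1, 1], [5, 1, 1], [5, 1, 1], [4, 2, 1], [4, 2, 1], [4, 1, 2], [3, 3, 1], [3, 3, 1], [3, 2, 2], [3, 1, 3]] by decide]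
    simp only [List.map_cons, List.map_nil, List.sum_cons, List.sum_nil]
    ring
  rw [← h, multipleZeta_three_one]
  ring

/-! ### The thirty-two multiple zeta values of weight `7` in terms of `ζ(7)`, `π²ζ(5)`, `π⁴ζ(3)`

Each evaluation is a linear consequence of the thirty-nine relations above, found by `linarith`
(the atoms being the MZVs of weight `7` and the two products `π²ζ(5)`, `π⁴ζ(3)`); of two dual
indices one is evaluated by duality. -/

/-- `ζ(2,1,1,1,1,1) = ζ(7)` (the double shuffle and duality relations of weight `7`). [cite: ChmutovDuzhinMostovoy2012, §10.2.6] -/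
theorem multipleZeta_two_one_one_one_one_one_eq :
    multipleZeta [2, 1, 1, 1, 1, 1] = multipleZeta [7] := by
  have R0 := stuffle_two_two_one_one_one_w7
  have R1 := stuffle_two_two_one_two_w7
  have R2 := stuffle_two_two_two_one_w7
  have R3 := stuffle_two_two_three_w7
  have R4 := stuffle_two_three_one_one_w7
  have R5 := stuffle_two_three_two_w7
  have R6 := stuffle_two_four_one_w7
  have R7 := stuffle_two_five_w7
  have R8 := stuffle_three_two_one_one_w7
  have R9 := stuffle_three_two_two_w7
  have R10 := stuffle_three_three_one_w7
  have R11 := stuffle_three_four_w7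
  have R12 := stuffle_two_one_two_one_one_w7
  have R13 := stuffle_two_one_two_two_w7
  have R14 := stuffle_two_one_three_one_w7
  have R15 := stuffle_two_one_four_w7
  have R16 := shuffle_two_five_w7
  have R17 := shuffle_two_four_one_w7
  have R18 := shuffle_two_three_two_w7
  have R19 := shuffle_two_two_three_w7
  have R20 := shuffle_three_four_w7
  have R21 := shuffle_three_two_two_w7
  have R22 := shuffle_three_three_one_w7
  have D0 := multipleZeta_two_one_one_one_one_one_eq_seven_dual
  have D1 := multipleZeta_two_one_one_one_two_eq_two_five_dual
  have D2 := multipleZeta_two_one_one_two_one_eq_three_four_dual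
  have D3 := multipleZeta_two_one_one_three_eq_two_one_four_dual
  have D4 := multipleZeta_two_one_two_one_one_eq_four_three_dual
  have D5 := multipleZeta_two_one_two_two_eq_two_two_three_dual
  have D6 := multipleZeta_two_one_three_one_eq_three_one_three_dual
  have D7 := multipleZeta_two_two_one_one_one_eq_five_two_dual
  have D8 := multipleZeta_two_two_one_two_eq_two_three_two_dual
  have D9 := multipleZeta_two_two_two_one_eq_three_two_two_dual
  have D10 := multipleZeta_two_three_one_one_eq_four_one_two_dual
  have D11 := multipleZeta_two_four_one_eq_three_one_one_two_dual
  have D12 := multipleZeta_three_one_one_one_one_eq_six_one_dual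
  have D13 := multipleZeta_three_one_two_one_eq_three_three_one_dual
  have D14 := multipleZeta_three_two_one_one_eq_four_two_one_dual
  have D15 := multipleZeta_four_one_one_one_eq_five_one_one_dual
  linarith

/-- `ζ(2,1,1,1,2) = 10 * ζ(7) - 2 / 3 * π²ζ(5) - 1 / 45 * π⁴ζ(3)` (the double shuffle and duality relations of weight `7`). [cite: ChmutovDuzhinMostovoy2012, §10.2.6] -/
theorem multipleZeta_two_one_one_one_two_eq :
    multipleZeta [2, 1, 1, 1, 2] = 10 * multipleZeta [7] - 2 / 3 * (Real.pi ^ 2 * multipleZeta [5]) - 1 / 45 * (Real.pi ^ 4 * multipleZeta [3]) := by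
  have R0 := stuffle_two_two_one_one_one_w7
  have R1 := stuffle_two_two_one_two_w7
  have R2 := stuffle_two_two_two_one_w7
  have R3 := stuffle_two_two_three_w7
  have R4 := stuffle_two_three_one_one_w7
  have R5 := stuffle_two_three_two_w7
  have R6 := stuffle_two_four_one_w7
  have R7 := stuffle_two_five_w7
  have R8 := stuffle_three_two_one_one_w7
  have R9 := stuffle_three_two_two_w7
  have R10 := stuffle_three_three_one_w7
  have R11 := stuffle_three_four_w7
  have R12 := stuffle_two_one_two_one_one_w7
  have R13 := stuffle_two_one_two_two_w7
  have R14 := stuffle_two_one_three_one_w7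
  have R15 := stuffle_two_one_four_w7
  have R16 := shuffle_two_five_w7
  have R17 := shuffle_two_four_one_w7
  have R18 := shuffle_two_three_two_w7
  have R19 := shuffle_two_two_three_w7
  have R20 := shuffle_three_four_w7
  have R21 := shuffle_three_two_two_w7
  have R22 := shuffle_three_three_one_w7
  have D0 := multipleZeta_two_one_one_one_one_one_eq_seven_dual
  have D1 := multipleZeta_two_one_one_one_two_eq_two_five_dual
  have D2 := multipleZeta_two_one_one_two_one_eq_three_four_dual
  have D3 := multipleZeta_two_one_one_three_eq_two_one_four_dual
  have D4 := multipleZeta_two_one_two_one_one_eq_four_three_dual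
  have D5 := multipleZeta_two_one_two_two_eq_two_two_three_dual
  have D6 := multipleZeta_two_one_three_one_eq_three_one_three_dual
  have D7 := multipleZeta_two_two_one_one_one_eq_five_two_dual
  have D8 := multipleZeta_two_two_one_two_eq_two_three_two_dual
  have D9 := multipleZeta_two_two_two_one_eq_three_two_two_dual
  have D10 := multipleZeta_two_three_one_one_eq_four_one_two_dual
  have D11 := multipleZeta_two_four_one_eq_three_one_one_two_dual
  have D12 := multipleZeta_three_one_one_one_one_eq_six_one_dual
  have D13 := multipleZeta_three_one_two_one_eq_three_three_one_dual
  have D14 := multipleZeta_three_two_one_one_eq_four_two_one_dual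
  have D15 := multipleZeta_four_one_one_one_eq_five_one_one_dual
  linarith

/-- `ζ(2,1,1,2,1) = -(18 * ζ(7)) + 5 / 3 * π²ζ(5) + 1 / 90 * π⁴ζ(3)` (the double shuffle and duality relations of weight `7`). [cite: ChmutovDuzhinMostovoy2012, §10.2.6] -/
theorem multipleZeta_two_one_one_two_one_eq :
    multipleZeta [2, 1, 1, 2, 1] = -(18 * multipleZeta [7]) + 5 / 3 * (Real.pi ^ 2 * multipleZeta [5]) + 1 / 90 * (Real.pi ^ 4 * multipleZeta [3]) := by
  have R0 := stuffle_two_two_one_one_one_w7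
  have R1 := stuffle_two_two_one_two_w7
  have R2 := stuffle_two_two_two_one_w7
  have R3 := stuffle_two_two_three_w7
  have R4 := stuffle_two_three_one_one_w7
  have R5 := stuffle_two_three_two_w7
  have R6 := stuffle_two_four_one_w7
  have R7 := stuffle_two_five_w7
  have R8 := stuffle_three_two_one_one_w7
  have R9 := stuffle_three_two_two_w7
  have R10 := stuffle_three_three_one_w7
  have R11 := stuffle_three_four_w7
  have R12 := stuffle_two_one_two_one_one_w7
  have R13 := stuffle_two_one_two_two_w7
  have R14 := stuffle_two_one_three_one_w7
  have R15 := stuffle_two_one_four_w7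
  have R16 := shuffle_two_five_w7
  have R17 := shuffle_two_four_one_w7
  have R18 := shuffle_two_three_two_w7
  have R19 := shuffle_two_two_three_w7
  have R20 := shuffle_three_four_w7
  have R21 := shuffle_three_two_two_w7
  have R22 := shuffle_three_three_one_w7
  have D0 := multipleZeta_two_one_one_one_one_one_eq_seven_dual
  have D1 := multipleZeta_two_one_one_one_two_eq_two_five_dual
  have D2 := multipleZeta_two_one_one_two_one_eq_three_four_dual
  have D3 := multipleZeta_two_one_one_three_eq_two_one_four_dual
  have D4 := multipleZeta_two_one_two_one_one_eq_four_three_dual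
  have D5 := multipleZeta_two_one_two_two_eq_two_two_three_dual
  have D6 := multipleZeta_two_one_three_one_eq_three_one_three_dual
  have D7 := multipleZeta_two_two_one_one_one_eq_five_two_dual
  have D8 := multipleZeta_two_two_one_two_eq_two_three_two_dual
  have D9 := multipleZeta_two_two_two_one_eq_three_two_two_dual
  have D10 := multipleZeta_two_three_one_one_eq_four_one_two_dual
  have D11 := multipleZeta_two_four_one_eq_three_one_one_two_dual
  have D12 := multipleZeta_three_one_one_one_one_eq_six_one_dual
  have D13 := multipleZeta_three_one_two_one_eq_three_three_one_dual
  have D14 := multipleZeta_three_two_one_one_eq_four_two_one_dual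
  have D15 := multipleZeta_four_one_one_one_eq_five_one_one_dual
  linarith

/-- `ζ(2,1,1,3) = 61 / 8 * ζ(7) - 11 / 12 * π²ζ(5) + 7 / 360 * π⁴ζ(3)` (the double shuffle and duality relations of weight `7`). [cite: ChmutovDuzhinMostovoy2012, §10.2.6] -/
theorem multipleZeta_two_one_one_three_eq :
    multipleZeta [2, 1, 1, 3] = 61 / 8 * multipleZeta [7] - 11 / 12 * (Real.pi ^ 2 * multipleZeta [5]) + 7 / 360 * (Real.pi ^ 4 * multipleZeta [3]) := by
  have R0 := stuffle_two_two_one_one_one_w7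
  have R1 := stuffle_two_two_one_two_w7
  have R2 := stuffle_two_two_two_one_w7
  have R3 := stuffle_two_two_three_w7
  have R4 := stuffle_two_three_one_one_w7
  have R5 := stuffle_two_three_two_w7
  have R6 := stuffle_two_four_one_w7
  have R7 := stuffle_two_five_w7
  have R8 := stuffle_three_two_one_one_w7
  have R9 := stuffle_three_two_two_w7
  have R10 := stuffle_three_three_one_w7
  have R11 := stuffle_three_four_w7
  have R12 := stuffle_two_one_two_one_one_w7
  have R13 := stuffle_two_one_two_two_w7
  have R14 := stuffle_two_one_three_one_w7
  have R15 := stuffle_two_one_four_w7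
  have R16 := shuffle_two_five_w7
  have R17 := shuffle_two_four_one_w7
  have R18 := shuffle_two_three_two_w7
  have R19 := shuffle_two_two_three_w7
  have R20 := shuffle_three_four_w7
  have R21 := shuffle_three_two_two_w7
  have R22 := shuffle_three_three_one_w7
  have D0 := multipleZeta_two_one_one_one_one_one_eq_seven_dual
  have D1 := multipleZeta_two_one_one_one_two_eq_two_five_dual
  have D2 := multipleZeta_two_one_one_two_one_eq_three_four_dual
  have D3 := multipleZeta_two_one_one_three_eq_two_one_four_dual
  have D4 := multipleZeta_two_one_two_one_one_eq_four_three_dual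
  have D5 := multipleZeta_two_one_two_two_eq_two_two_three_dual
  have D6 := multipleZeta_two_one_three_one_eq_three_one_three_dual
  have D7 := multipleZeta_two_two_one_one_one_eq_five_two_dual
  have D8 := multipleZeta_two_two_one_two_eq_two_three_two_dual
  have D9 := multipleZeta_two_two_two_one_eq_three_two_two_dual
  have D10 := multipleZeta_two_three_one_one_eq_four_one_two_dual
  have D11 := multipleZeta_two_four_one_eq_three_one_one_two_dual
  have D12 := multipleZeta_three_one_one_one_one_eq_six_one_dual
  have D13 := multipleZeta_three_one_two_one_eq_three_three_one_dual
  have D14 := multipleZeta_three_two_one_one_eq_four_two_one_dual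
  have D15 := multipleZeta_four_one_one_one_eq_five_one_one_dual
  linarith

/-- `ζ(2,1,2,1,1) = 17 * ζ(7) - 5 / 3 * π²ζ(5)` (the double shuffle and duality relations of weight `7`). [cite: ChmutovDuzhinMostovoy2012, §10.2.6] -/
theorem multipleZeta_two_one_two_one_one_eq :
    multipleZeta [2, 1, 2, 1, 1] = 17 * multipleZeta [7] - 5 / 3 * (Real.pi ^ 2 * multipleZeta [5]) := by
  have R0 := stuffle_two_two_one_one_one_w7
  have R1 := stuffle_two_two_one_two_w7
  have R2 := stuffle_two_two_two_one_w7
  have R3 := stuffle_two_two_three_w7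
  have R4 := stuffle_two_three_one_one_w7
  have R5 := stuffle_two_three_two_w7
  have R6 := stuffle_two_four_one_w7
  have R7 := stuffle_two_five_w7
  have R8 := stuffle_three_two_one_one_w7
  have R9 := stuffle_three_two_two_w7
  have R10 := stuffle_three_three_one_w7
  have R11 := stuffle_three_four_w7
  have R12 := stuffle_two_one_two_one_one_w7
  have R13 := stuffle_two_one_two_two_w7
  have R14 := stuffle_two_one_three_one_w7
  have R15 := stuffle_two_one_four_w7
  have R16 := shuffle_two_five_w7
  have R17 := shuffle_two_four_one_w7
  have R18 := shuffle_two_three_two_w7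
  have R19 := shuffle_two_two_three_w7
  have R20 := shuffle_three_four_w7
  have R21 := shuffle_three_two_two_w7
  have R22 := shuffle_three_three_one_w7
  have D0 := multipleZeta_two_one_one_one_one_one_eq_seven_dual
  have D1 := multipleZeta_two_one_one_one_two_eq_two_five_dual
  have D2 := multipleZeta_two_one_one_two_one_eq_three_four_dual
  have D3 := multipleZeta_two_one_one_three_eq_two_one_four_dual
  have D4 := multipleZeta_two_one_two_one_one_eq_four_three_dual
  have D5 := multipleZeta_two_one_two_two_eq_two_two_three_dual
  have D6 := multipleZeta_two_one_three_one_eq_three_one_three_dual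
  have D7 := multipleZeta_two_two_one_one_one_eq_five_two_dual
  have D8 := multipleZeta_two_two_one_two_eq_two_three_two_dual
  have D9 := multipleZeta_two_two_two_one_eq_three_two_two_dual
  have D10 := multipleZeta_two_three_one_one_eq_four_one_two_dual
  have D11 := multipleZeta_two_four_one_eq_three_one_one_two_dual
  have D12 := multipleZeta_three_one_one_one_one_eq_six_one_dual
  have D13 := multipleZeta_three_one_two_one_eq_three_three_one_dual
  have D14 := multipleZeta_three_two_one_one_eq_four_two_one_dual
  have D15 := multipleZeta_four_one_one_one_eq_five_one_one_dual
  linarith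

/-- `ζ(2,1,2,2) = -(291 / 16 * ζ(7)) + 2 * π²ζ(5) - 1 / 60 * π⁴ζ(3)` (the double shuffle and duality relations of weight `7`). [cite: ChmutovDuzhinMostovoy2012, §10.2.6] -/
theorem multipleZeta_two_one_two_two_eq :
    multipleZeta [2, 1, 2, 2] = -(291 / 16 * multipleZeta [7]) + 2 * (Real.pi ^ 2 * multipleZeta [5]) - 1 / 60 * (Real.pi ^ 4 * multipleZeta [3]) := by
  have R0 := stuffle_two_two_one_one_one_w7
  have R1 := stuffle_two_two_one_two_w7
  have R2 := stuffle_two_two_two_one_w7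
  have R3 := stuffle_two_two_three_w7
  have R4 := stuffle_two_three_one_one_w7
  have R5 := stuffle_two_three_two_w7
  have R6 := stuffle_two_four_one_w7
  have R7 := stuffle_two_five_w7
  have R8 := stuffle_three_two_one_one_w7
  have R9 := stuffle_three_two_two_w7
  have R10 := stuffle_three_three_one_w7
  have R11 := stuffle_three_four_w7
  have R12 := stuffle_two_one_two_one_one_w7
  have R13 := stuffle_two_one_two_two_w7
  have R14 := stuffle_two_one_three_one_w7
  have R15 := stuffle_two_one_four_w7
  have R16 := shuffle_two_five_w7
  have R17 := shuffle_two_four_one_w7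
  have R18 := shuffle_two_three_two_w7
  have R19 := shuffle_two_two_three_w7
  have R20 := shuffle_three_four_w7
  have R21 := shuffle_three_two_two_w7
  have R22 := shuffle_three_three_one_w7
  have D0 := multipleZeta_two_one_one_one_one_one_eq_seven_dual
  have D1 := multipleZeta_two_one_one_one_two_eq_two_five_dual
  have D2 := multipleZeta_two_one_one_two_one_eq_three_four_dual
  have D3 := multipleZeta_two_one_one_three_eq_two_one_four_dual
  have D4 := multipleZeta_two_one_two_one_one_eq_four_three_dual
  have D5 := multipleZeta_two_one_two_two_eq_two_two_three_dual
  have D6 := multipleZeta_two_one_three_one_eq_three_one_three_dual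
  have D7 := multipleZeta_two_two_one_one_one_eq_five_two_dual
  have D8 := multipleZeta_two_two_one_two_eq_two_three_two_dual
  have D9 := multipleZeta_two_two_two_one_eq_three_two_two_dual
  have D10 := multipleZeta_two_three_one_one_eq_four_one_two_dual
  have D11 := multipleZeta_two_four_one_eq_three_one_one_two_dual
  have D12 := multipleZeta_three_one_one_one_one_eq_six_one_dual
  have D13 := multipleZeta_three_one_two_one_eq_three_three_one_dual
  have D14 := multipleZeta_three_two_one_one_eq_four_two_one_dual
  have D15 := multipleZeta_four_one_one_one_eq_five_one_one_dual
  linarith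

/-- `ζ(2,1,3,1) = -(1 / 4 * ζ(7)) + 1 / 360 * π⁴ζ(3)` (the double shuffle and duality relations of weight `7`). [cite: ChmutovDuzhinMostovoy2012, §10.2.6] -/
theorem multipleZeta_two_one_three_one_eq :
    multipleZeta [2, 1, 3, 1] = -(1 / 4 * multipleZeta [7]) + 1 / 360 * (Real.pi ^ 4 * multipleZeta [3]) := by
  have R0 := stuffle_two_two_one_one_one_w7
  have R1 := stuffle_two_two_one_two_w7
  have R2 := stuffle_two_two_two_one_w7
  have R3 := stuffle_two_two_three_w7
  have R4 := stuffle_two_three_one_one_w7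
  have R5 := stuffle_two_three_two_w7
  have R6 := stuffle_two_four_one_w7
  have R7 := stuffle_two_five_w7
  have R8 := stuffle_three_two_one_one_w7
  have R9 := stuffle_three_two_two_w7
  have R10 := stuffle_three_three_one_w7
  have R11 := stuffle_three_four_w7
  have R12 := stuffle_two_one_two_one_one_w7
  have R13 := stuffle_two_one_two_two_w7
  have R14 := stuffle_two_one_three_one_w7
  have R15 := stuffle_two_one_four_w7
  have R16 := shuffle_two_five_w7
  have R17 := shuffle_two_four_one_w7
  have R18 := shuffle_two_three_two_w7
  have R19 := shuffle_two_two_three_w7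
  have R20 := shuffle_three_four_w7
  have R21 := shuffle_three_two_two_w7
  have R22 := shuffle_three_three_one_w7
  have D0 := multipleZeta_two_one_one_one_one_one_eq_seven_dual
  have D1 := multipleZeta_two_one_one_one_two_eq_two_five_dual
  have D2 := multipleZeta_two_one_one_two_one_eq_three_four_dual
  have D3 := multipleZeta_two_one_one_three_eq_two_one_four_dual
  have D4 := multipleZeta_two_one_two_one_one_eq_four_three_dual
  have D5 := multipleZeta_two_one_two_two_eq_two_two_three_dual
  have D6 := multipleZeta_two_one_three_one_eq_three_one_three_dual
  have D7 := multipleZeta_two_two_one_one_one_eq_five_two_dual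
  have D8 := multipleZeta_two_two_one_two_eq_two_three_two_dual
  have D9 := multipleZeta_two_two_two_one_eq_three_two_two_dual
  have D10 := multipleZeta_two_three_one_one_eq_four_one_two_dual
  have D11 := multipleZeta_two_four_one_eq_three_one_one_two_dual
  have D12 := multipleZeta_three_one_one_one_one_eq_six_one_dual
  have D13 := multipleZeta_three_one_two_one_eq_three_three_one_dual
  have D14 := multipleZeta_three_two_one_one_eq_four_two_one_dual
  have D15 := multipleZeta_four_one_one_one_eq_five_one_one_dual
  linarith

/-- `ζ(2,1,4) = 61 / 8 * ζ(7) - 11 / 12 * π²ζ(5) + 7 / 360 * π⁴ζ(3)` (the double shuffle and duality relations of weight `7`). [cite: ChmutovDuzhinMostovoy2012, §10.2.6] -/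
theorem multipleZeta_two_one_four_eq :
    multipleZeta [2, 1, 4] = 61 / 8 * multipleZeta [7] - 11 / 12 * (Real.pi ^ 2 * multipleZeta [5]) + 7 / 360 * (Real.pi ^ 4 * multipleZeta [3]) := by
  rw [← multipleZeta_two_one_one_three_eq_two_one_four_dual]
  exact multipleZeta_two_one_one_three_eq

/-- `ζ(2,2,1,1,1) = -(11 * ζ(7)) + 5 / 6 * π²ζ(5) + 1 / 45 * π⁴ζ(3)` (the double shuffle and duality relations of weight `7`). [cite: ChmutovDuzhinMostovoy2012, §10.2.6] -/
theorem multipleZeta_two_two_one_one_one_eq :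
    multipleZeta [2, 2, 1, 1, 1] = -(11 * multipleZeta [7]) + 5 / 6 * (Real.pi ^ 2 * multipleZeta [5]) + 1 / 45 * (Real.pi ^ 4 * multipleZeta [3]) := by
  have R0 := stuffle_two_two_one_one_one_w7
  have R1 := stuffle_two_two_one_two_w7
  have R2 := stuffle_two_two_two_one_w7
  have R3 := stuffle_two_two_three_w7
  have R4 := stuffle_two_three_one_one_w7
  have R5 := stuffle_two_three_two_w7
  have R6 := stuffle_two_four_one_w7
  have R7 := stuffle_two_five_w7
  have R8 := stuffle_three_two_one_one_w7
  have R9 := stuffle_three_two_two_w7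
  have R10 := stuffle_three_three_one_w7
  have R11 := stuffle_three_four_w7
  have R12 := stuffle_two_one_two_one_one_w7
  have R13 := stuffle_two_one_two_two_w7
  have R14 := stuffle_two_one_three_one_w7
  have R15 := stuffle_two_one_four_w7
  have R16 := shuffle_two_five_w7
  have R17 := shuffle_two_four_one_w7
  have R18 := shuffle_two_three_two_w7
  have R19 := shuffle_two_two_three_w7
  have R20 := shuffle_three_four_w7
  have R21 := shuffle_three_two_two_w7
  have R22 := shuffle_three_three_one_w7
  have D0 := multipleZeta_two_one_one_one_one_one_eq_seven_dual
  have D1 := multipleZeta_two_one_one_one_two_eq_two_five_dual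
  have D2 := multipleZeta_two_one_one_two_one_eq_three_four_dual
  have D3 := multipleZeta_two_one_one_three_eq_two_one_four_dual
  have D4 := multipleZeta_two_one_two_one_one_eq_four_three_dual
  have D5 := multipleZeta_two_one_two_two_eq_two_two_three_dual
  have D6 := multipleZeta_two_one_three_one_eq_three_one_three_dual
  have D7 := multipleZeta_two_two_one_one_one_eq_five_two_dual
  have D8 := multipleZeta_two_two_one_two_eq_two_three_two_dual
  have D9 := multipleZeta_two_two_two_one_eq_three_two_two_dual
  have D10 := multipleZeta_two_three_one_one_eq_four_one_two_dual
  have D11 := multipleZeta_two_four_one_eq_three_one_one_two_dual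
  have D12 := multipleZeta_three_one_one_one_one_eq_six_one_dual
  have D13 := multipleZeta_three_one_two_one_eq_three_three_one_dual
  have D14 := multipleZeta_three_two_one_one_eq_four_two_one_dual
  have D15 := multipleZeta_four_one_one_one_eq_five_one_one_dual
  linarith

/-- `ζ(2,2,1,2) = 75 / 8 * ζ(7) - 11 / 12 * π²ζ(5)` (the double shuffle and duality relations of weight `7`). [cite: ChmutovDuzhinMostovoy2012, §10.2.6] -/
theorem multipleZeta_two_two_one_two_eq :
    multipleZeta [2, 2, 1, 2] = 75 / 8 * multipleZeta [7] - 11 / 12 * (Real.pi ^ 2 * multipleZeta [5]) := by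
  have R0 := stuffle_two_two_one_one_one_w7
  have R1 := stuffle_two_two_one_two_w7
  have R2 := stuffle_two_two_two_one_w7
  have R3 := stuffle_two_two_three_w7
  have R4 := stuffle_two_three_one_one_w7
  have R5 := stuffle_two_three_two_w7
  have R6 := stuffle_two_four_one_w7
  have R7 := stuffle_two_five_w7
  have R8 := stuffle_three_two_one_one_w7
  have R9 := stuffle_three_two_two_w7
  have R10 := stuffle_three_three_one_w7
  have R11 := stuffle_three_four_w7
  have R12 := stuffle_two_one_two_one_one_w7
  have R13 := stuffle_two_one_two_two_w7
  have R14 := stuffle_two_one_three_one_w7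
  have R15 := stuffle_two_one_four_w7
  have R16 := shuffle_two_five_w7
  have R17 := shuffle_two_four_one_w7
  have R18 := shuffle_two_three_two_w7
  have R19 := shuffle_two_two_three_w7
  have R20 := shuffle_three_four_w7
  have R21 := shuffle_three_two_two_w7
  have R22 := shuffle_three_three_one_w7
  have D0 := multipleZeta_two_one_one_one_one_one_eq_seven_dual
  have D1 := multipleZeta_two_one_one_one_two_eq_two_five_dual
  have D2 := multipleZeta_two_one_one_two_one_eq_three_four_dual
  have D3 := multipleZeta_two_one_one_three_eq_two_one_four_dual
  have D4 := multipleZeta_two_one_two_one_one_eq_four_three_dual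
  have D5 := multipleZeta_two_one_two_two_eq_two_two_three_dual
  have D6 := multipleZeta_two_one_three_one_eq_three_one_three_dual
  have D7 := multipleZeta_two_two_one_one_one_eq_five_two_dual
  have D8 := multipleZeta_two_two_one_two_eq_two_three_two_dual
  have D9 := multipleZeta_two_two_two_one_eq_three_two_two_dual
  have D10 := multipleZeta_two_three_one_one_eq_four_one_two_dual
  have D11 := multipleZeta_two_four_one_eq_three_one_one_two_dual
  have D12 := multipleZeta_three_one_one_one_one_eq_six_one_dual
  have D13 := multipleZeta_three_one_two_one_eq_three_three_one_dual
  have D14 := multipleZeta_three_two_one_one_eq_four_two_one_dual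
  have D15 := multipleZeta_four_one_one_one_eq_five_one_one_dual
  linarith

/-- `ζ(2,2,2,1) = 157 / 16 * ζ(7) - 5 / 4 * π²ζ(5) + 1 / 40 * π⁴ζ(3)` (the double shuffle and duality relations of weight `7`). [cite: ChmutovDuzhinMostovoy2012, §10.2.6] -/
theorem multipleZeta_two_two_two_one_eq :
    multipleZeta [2, 2, 2, 1] = 157 / 16 * multipleZeta [7] - 5 / 4 * (Real.pi ^ 2 * multipleZeta [5]) + 1 / 40 * (Real.pi ^ 4 * multipleZeta [3]) := by
  have R0 := stuffle_two_two_one_one_one_w7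
  have R1 := stuffle_two_two_one_two_w7
  have R2 := stuffle_two_two_two_one_w7
  have R3 := stuffle_two_two_three_w7
  have R4 := stuffle_two_three_one_one_w7
  have R5 := stuffle_two_three_two_w7
  have R6 := stuffle_two_four_one_w7
  have R7 := stuffle_two_five_w7
  have R8 := stuffle_three_two_one_one_w7
  have R9 := stuffle_three_two_two_w7
  have R10 := stuffle_three_three_one_w7
  have R11 := stuffle_three_four_w7
  have R12 := stuffle_two_one_two_one_one_w7
  have R13 := stuffle_two_one_two_two_w7
  have R14 := stuffle_two_one_three_one_w7
  have R15 := stuffle_two_one_four_w7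
  have R16 := shuffle_two_five_w7
  have R17 := shuffle_two_four_one_w7
  have R18 := shuffle_two_three_two_w7
  have R19 := shuffle_two_two_three_w7
  have R20 := shuffle_three_four_w7
  have R21 := shuffle_three_two_two_w7
  have R22 := shuffle_three_three_one_w7
  have D0 := multipleZeta_two_one_one_one_one_one_eq_seven_dual
  have D1 := multipleZeta_two_one_one_one_two_eq_two_five_dual
  have D2 := multipleZeta_two_one_one_two_one_eq_three_four_dual
  have D3 := multipleZeta_two_one_one_three_eq_two_one_four_dual
  have D4 := multipleZeta_two_one_two_one_one_eq_four_three_dual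
  have D5 := multipleZeta_two_one_two_two_eq_two_two_three_dual
  have D6 := multipleZeta_two_one_three_one_eq_three_one_three_dual
  have D7 := multipleZeta_two_two_one_one_one_eq_five_two_dual
  have D8 := multipleZeta_two_two_one_two_eq_two_three_two_dual
  have D9 := multipleZeta_two_two_two_one_eq_three_two_two_dual
  have D10 := multipleZeta_two_three_one_one_eq_four_one_two_dual
  have D11 := multipleZeta_two_four_one_eq_three_one_one_two_dual
  have D12 := multipleZeta_three_one_one_one_one_eq_six_one_dual
  have D13 := multipleZeta_three_one_two_one_eq_three_three_one_dual
  have D14 := multipleZeta_three_two_one_one_eq_four_two_one_dual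
  have D15 := multipleZeta_four_one_one_one_eq_five_one_one_dual
  linarith

/-- `ζ(2,2,3) = -(291 / 16 * ζ(7)) + 2 * π²ζ(5) - 1 / 60 * π⁴ζ(3)` (the double shuffle and duality relations of weight `7`). [cite: ChmutovDuzhinMostovoy2012, §10.2.6] -/
theorem multipleZeta_two_two_three_eq :
    multipleZeta [2, 2, 3] = -(291 / 16 * multipleZeta [7]) + 2 * (Real.pi ^ 2 * multipleZeta [5]) - 1 / 60 * (Real.pi ^ 4 * multipleZeta [3]) := by
  rw [← multipleZeta_two_one_two_two_eq_two_two_three_dual]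
  exact multipleZeta_two_one_two_two_eq

/-- `ζ(2,3,1,1) = 5 / 8 * ζ(7) + 5 / 12 * π²ζ(5) - 1 / 24 * π⁴ζ(3)` (the double shuffle and duality relations of weight `7`). [cite: ChmutovDuzhinMostovoy2012, §10.2.6] -/
theorem multipleZeta_two_three_one_one_eq :
    multipleZeta [2, 3, 1, 1] = 5 / 8 * multipleZeta [7] + 5 / 12 * (Real.pi ^ 2 * multipleZeta [5]) - 1 / 24 * (Real.pi ^ 4 * multipleZeta [3]) := by
  have R0 := stuffle_two_two_one_one_one_w7
  have R1 := stuffle_two_two_one_two_w7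
  have R2 := stuffle_two_two_two_one_w7
  have R3 := stuffle_two_two_three_w7
  have R4 := stuffle_two_three_one_one_w7
  have R5 := stuffle_two_three_two_w7
  have R6 := stuffle_two_four_one_w7
  have R7 := stuffle_two_five_w7
  have R8 := stuffle_three_two_one_one_w7
  have R9 := stuffle_three_two_two_w7
  have R10 := stuffle_three_three_one_w7
  have R11 := stuffle_three_four_w7
  have R12 := stuffle_two_one_two_one_one_w7
  have R13 := stuffle_two_one_two_two_w7
  have R14 := stuffle_two_one_three_one_w7
  have R15 := stuffle_two_one_four_w7
  have R16 := shuffle_two_five_w7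
  have R17 := shuffle_two_four_one_w7
  have R18 := shuffle_two_three_two_w7
  have R19 := shuffle_two_two_three_w7
  have R20 := shuffle_three_four_w7
  have R21 := shuffle_three_two_two_w7
  have R22 := shuffle_three_three_one_w7
  have D0 := multipleZeta_two_one_one_one_one_one_eq_seven_dual
  have D1 := multipleZeta_two_one_one_one_two_eq_two_five_dual
  have D2 := multipleZeta_two_one_one_two_one_eq_three_four_dual
  have D3 := multipleZeta_two_one_one_three_eq_two_one_four_dual
  have D4 := multipleZeta_two_one_two_one_one_eq_four_three_dual
  have D5 := multipleZeta_two_one_two_two_eq_two_two_three_dual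
  have D6 := multipleZeta_two_one_three_one_eq_three_one_three_dual
  have D7 := multipleZeta_two_two_one_one_one_eq_five_two_dual
  have D8 := multipleZeta_two_two_one_two_eq_two_three_two_dual
  have D9 := multipleZeta_two_two_two_one_eq_three_two_two_dual
  have D10 := multipleZeta_two_three_one_one_eq_four_one_two_dual
  have D11 := multipleZeta_two_four_one_eq_three_one_one_two_dual
  have D12 := multipleZeta_three_one_one_one_one_eq_six_one_dual
  have D13 := multipleZeta_three_one_two_one_eq_three_three_one_dual
  have D14 := multipleZeta_three_two_one_one_eq_four_two_one_dual
  have D15 := multipleZeta_four_one_one_one_eq_five_one_one_dual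
  linarith

/-- `ζ(2,3,2) = 75 / 8 * ζ(7) - 11 / 12 * π²ζ(5)` (the double shuffle and duality relations of weight `7`). [cite: ChmutovDuzhinMostovoy2012, §10.2.6] -/
theorem multipleZeta_two_three_two_eq :
    multipleZeta [2, 3, 2] = 75 / 8 * multipleZeta [7] - 11 / 12 * (Real.pi ^ 2 * multipleZeta [5]) := by
  rw [← multipleZeta_two_two_one_two_eq_two_three_two_dual]
  exact multipleZeta_two_two_one_two_eq

/-- `ζ(2,4,1) = -(109 / 16 * ζ(7)) + 5 / 6 * π²ζ(5) - 1 / 72 * π⁴ζ(3)` (the double shuffle and duality relations of weight `7`). [cite: ChmutovDuzhinMostovoy2012, §10.2.6] -/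
theorem multipleZeta_two_four_one_eq :
    multipleZeta [2, 4, 1] = -(109 / 16 * multipleZeta [7]) + 5 / 6 * (Real.pi ^ 2 * multipleZeta [5]) - 1 / 72 * (Real.pi ^ 4 * multipleZeta [3]) := by
  have R0 := stuffle_two_two_one_one_one_w7
  have R1 := stuffle_two_two_one_two_w7
  have R2 := stuffle_two_two_two_one_w7
  have R3 := stuffle_two_two_three_w7
  have R4 := stuffle_two_three_one_one_w7
  have R5 := stuffle_two_three_two_w7
  have R6 := stuffle_two_four_one_w7
  have R7 := stuffle_two_five_w7
  have R8 := stuffle_three_two_one_one_w7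
  have R9 := stuffle_three_two_two_w7
  have R10 := stuffle_three_three_one_w7
  have R11 := stuffle_three_four_w7
  have R12 := stuffle_two_one_two_one_one_w7
  have R13 := stuffle_two_one_two_two_w7
  have R14 := stuffle_two_one_three_one_w7
  have R15 := stuffle_two_one_four_w7
  have R16 := shuffle_two_five_w7
  have R17 := shuffle_two_four_one_w7
  have R18 := shuffle_two_three_two_w7
  have R19 := shuffle_two_two_three_w7
  have R20 := shuffle_three_four_w7
  have R21 := shuffle_three_two_two_w7
  have R22 := shuffle_three_three_one_w7
  have D0 := multipleZeta_two_one_one_one_one_one_eq_seven_dual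
  have D1 := multipleZeta_two_one_one_one_two_eq_two_five_dual
  have D2 := multipleZeta_two_one_one_two_one_eq_three_four_dual
  have D3 := multipleZeta_two_one_one_three_eq_two_one_four_dual
  have D4 := multipleZeta_two_one_two_one_one_eq_four_three_dual
  have D5 := multipleZeta_two_one_two_two_eq_two_two_three_dual
  have D6 := multipleZeta_two_one_three_one_eq_three_one_three_dual
  have D7 := multipleZeta_two_two_one_one_one_eq_five_two_dual
  have D8 := multipleZeta_two_two_one_two_eq_two_three_two_dual
  have D9 := multipleZeta_two_two_two_one_eq_three_two_two_dual
  have D10 := multipleZeta_two_three_one_one_eq_four_one_two_dual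
  have D11 := multipleZeta_two_four_one_eq_three_one_one_two_dual
  have D12 := multipleZeta_three_one_one_one_one_eq_six_one_dual
  have D13 := multipleZeta_three_one_two_one_eq_three_three_one_dual
  have D14 := multipleZeta_three_two_one_one_eq_four_two_one_dual
  have D15 := multipleZeta_four_one_one_one_eq_five_one_one_dual
  linarith

/-- `ζ(2,5) = 10ζ(7) - 4ζ(2)ζ(5) - 2ζ(3)ζ(4)` (the double shuffle and duality relations of weight `7`). [cite: ChmutovDuzhinMostovoy2012, §10.2.6] -/
theorem multipleZeta_two_five_eq :
    multipleZeta [2, 5] = 10 * multipleZeta [7] - 2 / 3 * (Real.pi ^ 2 * multipleZeta [5]) - 1 / 45 * (Real.pi ^ 4 * multipleZeta [3]) := by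
  rw [← multipleZeta_two_one_one_one_two_eq_two_five_dual]
  exact multipleZeta_two_one_one_one_two_eq

/-- `ζ(3,1,1,1,1) = 3 * ζ(7) - 1 / 6 * π²ζ(5) - 1 / 90 * π⁴ζ(3)` (the double shuffle and duality relations of weight `7`). [cite: ChmutovDuzhinMostovoy2012, §10.2.6] -/
theorem multipleZeta_three_one_one_one_one_eq :
    multipleZeta [3, 1, 1, 1, 1] = 3 * multipleZeta [7] - 1 / 6 * (Real.pi ^ 2 * multipleZeta [5]) - 1 / 90 * (Real.pi ^ 4 * multipleZeta [3]) := by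
  have R0 := stuffle_two_two_one_one_one_w7
  have R1 := stuffle_two_two_one_two_w7
  have R2 := stuffle_two_two_two_one_w7
  have R3 := stuffle_two_two_three_w7
  have R4 := stuffle_two_three_one_one_w7
  have R5 := stuffle_two_three_two_w7
  have R6 := stuffle_two_four_one_w7
  have R7 := stuffle_two_five_w7
  have R8 := stuffle_three_two_one_one_w7
  have R9 := stuffle_three_two_two_w7
  have R10 := stuffle_three_three_one_w7
  have R11 := stuffle_three_four_w7
  have R12 := stuffle_two_one_two_one_one_w7
  have R13 := stuffle_two_one_two_two_w7
  have R14 := stuffle_two_one_three_one_w7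
  have R15 := stuffle_two_one_four_w7
  have R16 := shuffle_two_five_w7
  have R17 := shuffle_two_four_one_w7
  have R18 := shuffle_two_three_two_w7
  have R19 := shuffle_two_two_three_w7
  have R20 := shuffle_three_four_w7
  have R21 := shuffle_three_two_two_w7
  have R22 := shuffle_three_three_one_w7
  have D0 := multipleZeta_two_one_one_one_one_one_eq_seven_dual
  have D1 := multipleZeta_two_one_one_one_two_eq_two_five_dual
  have D2 := multipleZeta_two_one_one_two_one_eq_three_four_dual
  have D3 := multipleZeta_two_one_one_three_eq_two_one_four_dual
  have D4 := multipleZeta_two_one_two_one_one_eq_four_three_dual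
  have D5 := multipleZeta_two_one_two_two_eq_two_two_three_dual
  have D6 := multipleZeta_two_one_three_one_eq_three_one_three_dual
  have D7 := multipleZeta_two_two_one_one_one_eq_five_two_dual
  have D8 := multipleZeta_two_two_one_two_eq_two_three_two_dual
  have D9 := multipleZeta_two_two_two_one_eq_three_two_two_dual
  have D10 := multipleZeta_two_three_one_one_eq_four_one_two_dual
  have D11 := multipleZeta_two_four_one_eq_three_one_one_two_dual
  have D12 := multipleZeta_three_one_one_one_one_eq_six_one_dual
  have D13 := multipleZeta_three_one_two_one_eq_three_three_one_dual
  have D14 := multipleZeta_three_two_one_one_eq_four_two_one_dual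
  have D15 := multipleZeta_four_one_one_one_eq_five_one_one_dual
  linarith

/-- `ζ(3,1,1,2) = -(109 / 16 * ζ(7)) + 5 / 6 * π²ζ(5) - 1 / 72 * π⁴ζ(3)` (the double shuffle and duality relations of weight `7`). [cite: ChmutovDuzhinMostovoy2012, §10.2.6] -/
theorem multipleZeta_three_one_one_two_eq :
    multipleZeta [3, 1, 1, 2] = -(109 / 16 * multipleZeta [7]) + 5 / 6 * (Real.pi ^ 2 * multipleZeta [5]) - 1 / 72 * (Real.pi ^ 4 * multipleZeta [3]) := by
  rw [← multipleZeta_two_four_one_eq_three_one_one_two_dual]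
  exact multipleZeta_two_four_one_eq

/-- `ζ(3,1,2,1) = 61 / 8 * ζ(7) - 3 / 4 * π²ζ(5)` (the double shuffle and duality relations of weight `7`). [cite: ChmutovDuzhinMostovoy2012, §10.2.6] -/
theorem multipleZeta_three_one_two_one_eq :
    multipleZeta [3, 1, 2, 1] = 61 / 8 * multipleZeta [7] - 3 / 4 * (Real.pi ^ 2 * multipleZeta [5]) := by
  have R0 := stuffle_two_two_one_one_one_w7
  have R1 := stuffle_two_two_one_two_w7
  have R2 := stuffle_two_two_two_one_w7
  have R3 := stuffle_two_two_three_w7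
  have R4 := stuffle_two_three_one_one_w7
  have R5 := stuffle_two_three_two_w7
  have R6 := stuffle_two_four_one_w7
  have R7 := stuffle_two_five_w7
  have R8 := stuffle_three_two_one_one_w7
  have R9 := stuffle_three_two_two_w7
  have R10 := stuffle_three_three_one_w7
  have R11 := stuffle_three_four_w7
  have R12 := stuffle_two_one_two_one_one_w7
  have R13 := stuffle_two_one_two_two_w7
  have R14 := stuffle_two_one_three_one_w7
  have R15 := stuffle_two_one_four_w7
  have R16 := shuffle_two_five_w7
  have R17 := shuffle_two_four_one_w7
  have R18 := shuffle_two_three_two_w7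
  have R19 := shuffle_two_two_three_w7
  have R20 := shuffle_three_four_w7
  have R21 := shuffle_three_two_two_w7
  have R22 := shuffle_three_three_one_w7
  have D0 := multipleZeta_two_one_one_one_one_one_eq_seven_dual
  have D1 := multipleZeta_two_one_one_one_two_eq_two_five_dual
  have D2 := multipleZeta_two_one_one_two_one_eq_three_four_dual
  have D3 := multipleZeta_two_one_one_three_eq_two_one_four_dual
  have D4 := multipleZeta_two_one_two_one_one_eq_four_three_dual
  have D5 := multipleZeta_two_one_two_two_eq_two_two_three_dual
  have D6 := multipleZeta_two_one_three_one_eq_three_one_three_dual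
  have D7 := multipleZeta_two_two_one_one_one_eq_five_two_dual
  have D8 := multipleZeta_two_two_one_two_eq_two_three_two_dual
  have D9 := multipleZeta_two_two_two_one_eq_three_two_two_dual
  have D10 := multipleZeta_two_three_one_one_eq_four_one_two_dual
  have D11 := multipleZeta_two_four_one_eq_three_one_one_two_dual
  have D12 := multipleZeta_three_one_one_one_one_eq_six_one_dual
  have D13 := multipleZeta_three_one_two_one_eq_three_three_one_dual
  have D14 := multipleZeta_three_two_one_one_eq_four_two_one_dual
  have D15 := multipleZeta_four_one_one_one_eq_five_one_one_dual
  linarith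

/-- `ζ(3,1,3) = -(1 / 4 * ζ(7)) + 1 / 360 * π⁴ζ(3)` (the double shuffle and duality relations of weight `7`). [cite: ChmutovDuzhinMostovoy2012, §10.2.6] -/
theorem multipleZeta_three_one_three_eq :
    multipleZeta [3, 1, 3] = -(1 / 4 * multipleZeta [7]) + 1 / 360 * (Real.pi ^ 4 * multipleZeta [3]) := by
  rw [← multipleZeta_two_one_three_one_eq_three_one_three_dual]
  exact multipleZeta_two_one_three_one_eq

/-- `ζ(3,2,1,1) = -(221 / 16 * ζ(7)) + 11 / 12 * π²ζ(5) + 7 / 180 * π⁴ζ(3)` (the double shuffle and duality relations of weight `7`). [cite: ChmutovDuzhinMostovoy2012, §10.2.6] -/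
theorem multipleZeta_three_two_one_one_eq :
    multipleZeta [3, 2, 1, 1] = -(221 / 16 * multipleZeta [7]) + 11 / 12 * (Real.pi ^ 2 * multipleZeta [5]) + 7 / 180 * (Real.pi ^ 4 * multipleZeta [3]) := by
  have R0 := stuffle_two_two_one_one_one_w7
  have R1 := stuffle_two_two_one_two_w7
  have R2 := stuffle_two_two_two_one_w7
  have R3 := stuffle_two_two_three_w7
  have R4 := stuffle_two_three_one_one_w7
  have R5 := stuffle_two_three_two_w7
  have R6 := stuffle_two_four_one_w7
  have R7 := stuffle_two_five_w7
  have R8 := stuffle_three_two_one_one_w7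
  have R9 := stuffle_three_two_two_w7
  have R10 := stuffle_three_three_one_w7
  have R11 := stuffle_three_four_w7
  have R12 := stuffle_two_one_two_one_one_w7
  have R13 := stuffle_two_one_two_two_w7
  have R14 := stuffle_two_one_three_one_w7
  have R15 := stuffle_two_one_four_w7
  have R16 := shuffle_two_five_w7
  have R17 := shuffle_two_four_one_w7
  have R18 := shuffle_two_three_two_w7
  have R19 := shuffle_two_two_three_w7
  have R20 := shuffle_three_four_w7
  have R21 := shuffle_three_two_two_w7
  have R22 := shuffle_three_three_one_w7
  have D0 := multipleZeta_two_one_one_one_one_one_eq_seven_dual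
  have D1 := multipleZeta_two_one_one_one_two_eq_two_five_dual
  have D2 := multipleZeta_two_one_one_two_one_eq_three_four_dual
  have D3 := multipleZeta_two_one_one_three_eq_two_one_four_dual
  have D4 := multipleZeta_two_one_two_one_one_eq_four_three_dual
  have D5 := multipleZeta_two_one_two_two_eq_two_two_three_dual
  have D6 := multipleZeta_two_one_three_one_eq_three_one_three_dual
  have D7 := multipleZeta_two_two_one_one_one_eq_five_two_dual
  have D8 := multipleZeta_two_two_one_two_eq_two_three_two_dual
  have D9 := multipleZeta_two_two_two_one_eq_three_two_two_dual
  have D10 := multipleZeta_two_three_one_one_eq_four_one_two_dual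
  have D11 := multipleZeta_two_four_one_eq_three_one_one_two_dual
  have D12 := multipleZeta_three_one_one_one_one_eq_six_one_dual
  have D13 := multipleZeta_three_one_two_one_eq_three_three_one_dual
  have D14 := multipleZeta_three_two_one_one_eq_four_two_one_dual
  have D15 := multipleZeta_four_one_one_one_eq_five_one_one_dual
  linarith

/-- `ζ(3,2,2) = 157 / 16 * ζ(7) - 5 / 4 * π²ζ(5) + 1 / 40 * π⁴ζ(3)` (the double shuffle and duality relations of weight `7`). [cite: ChmutovDuzhinMostovoy2012, §10.2.6] -/
theorem multipleZeta_three_two_two_eq :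
    multipleZeta [3, 2, 2] = 157 / 16 * multipleZeta [7] - 5 / 4 * (Real.pi ^ 2 * multipleZeta [5]) + 1 / 40 * (Real.pi ^ 4 * multipleZeta [3]) := by
  rw [← multipleZeta_two_two_two_one_eq_three_two_two_dual]
  exact multipleZeta_two_two_two_one_eq

/-- `ζ(3,3,1) = 61 / 8 * ζ(7) - 3 / 4 * π²ζ(5)` (the double shuffle and duality relations of weight `7`). [cite: ChmutovDuzhinMostovoy2012, §10.2.6] -/
theorem multipleZeta_three_three_one_eq :
    multipleZeta [3, 3, 1] = 61 / 8 * multipleZeta [7] - 3 / 4 * (Real.pi ^ 2 * multipleZeta [5]) := by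
  rw [← multipleZeta_three_one_two_one_eq_three_three_one_dual]
  exact multipleZeta_three_one_two_one_eq

/-- `ζ(3,4) = -18ζ(7) + 10ζ(2)ζ(5) + ζ(3)ζ(4)` (the double shuffle and duality relations of weight `7`). [cite: ChmutovDuzhinMostovoy2012, §10.2.6] -/
theorem multipleZeta_three_four_eq :
    multipleZeta [3, 4] = -(18 * multipleZeta [7]) + 5 / 3 * (Real.pi ^ 2 * multipleZeta [5]) + 1 / 90 * (Real.pi ^ 4 * multipleZeta [3]) := by
  rw [← multipleZeta_two_one_one_two_one_eq_three_four_dual]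
  exact multipleZeta_two_one_one_two_one_eq

/-- `ζ(4,1,1,1) = 5 * ζ(7) - 1 / 3 * π²ζ(5) - 1 / 72 * π⁴ζ(3)` (the double shuffle and duality relations of weight `7`). [cite: ChmutovDuzhinMostovoy2012, §10.2.6] -/
theorem multipleZeta_four_one_one_one_eq :
    multipleZeta [4, 1, 1, 1] = 5 * multipleZeta [7] - 1 / 3 * (Real.pi ^ 2 * multipleZeta [5]) - 1 / 72 * (Real.pi ^ 4 * multipleZeta [3]) := by
  have R0 := stuffle_two_two_one_one_one_w7
  have R1 := stuffle_two_two_one_two_w7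
  have R2 := stuffle_two_two_two_one_w7
  have R3 := stuffle_two_two_three_w7
  have R4 := stuffle_two_three_one_one_w7
  have R5 := stuffle_two_three_two_w7
  have R6 := stuffle_two_four_one_w7
  have R7 := stuffle_two_five_w7
  have R8 := stuffle_three_two_one_one_w7
  have R9 := stuffle_three_two_two_w7
  have R10 := stuffle_three_three_one_w7
  have R11 := stuffle_three_four_w7
  have R12 := stuffle_two_one_two_one_one_w7
  have R13 := stuffle_two_one_two_two_w7
  have R14 := stuffle_two_one_three_one_w7
  have R15 := stuffle_two_one_four_w7
  have R16 := shuffle_two_five_w7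
  have R17 := shuffle_two_four_one_w7
  have R18 := shuffle_two_three_two_w7
  have R19 := shuffle_two_two_three_w7
  have R20 := shuffle_three_four_w7
  have R21 := shuffle_three_two_two_w7
  have R22 := shuffle_three_three_one_w7
  have D0 := multipleZeta_two_one_one_one_one_one_eq_seven_dual
  have D1 := multipleZeta_two_one_one_one_two_eq_two_five_dual
  have D2 := multipleZeta_two_one_one_two_one_eq_three_four_dual
  have D3 := multipleZeta_two_one_one_three_eq_two_one_four_dual
  have D4 := multipleZeta_two_one_two_one_one_eq_four_three_dual
  have D5 := multipleZeta_two_one_two_two_eq_two_two_three_dual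
  have D6 := multipleZeta_two_one_three_one_eq_three_one_three_dual
  have D7 := multipleZeta_two_two_one_one_one_eq_five_two_dual
  have D8 := multipleZeta_two_two_one_two_eq_two_three_two_dual
  have D9 := multipleZeta_two_two_two_one_eq_three_two_two_dual
  have D10 := multipleZeta_two_three_one_one_eq_four_one_two_dual
  have D11 := multipleZeta_two_four_one_eq_three_one_one_two_dual
  have D12 := multipleZeta_three_one_one_one_one_eq_six_one_dual
  have D13 := multipleZeta_three_one_two_one_eq_three_three_one_dual
  have D14 := multipleZeta_three_two_one_one_eq_four_two_one_dual
  have D15 := multipleZeta_four_one_one_one_eq_five_one_one_dual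
  linarith

/-- `ζ(4,1,2) = 5 / 8 * ζ(7) + 5 / 12 * π²ζ(5) - 1 / 24 * π⁴ζ(3)` (the double shuffle and duality relations of weight `7`). [cite: ChmutovDuzhinMostovoy2012, §10.2.6] -/
theorem multipleZeta_four_one_two_eq :
    multipleZeta [4, 1, 2] = 5 / 8 * multipleZeta [7] + 5 / 12 * (Real.pi ^ 2 * multipleZeta [5]) - 1 / 24 * (Real.pi ^ 4 * multipleZeta [3]) := by
  rw [← multipleZeta_two_three_one_one_eq_four_one_two_dual]
  exact multipleZeta_two_three_one_one_eq

/-- `ζ(4,2,1) = -(221 / 16 * ζ(7)) + 11 / 12 * π²ζ(5) + 7 / 180 * π⁴ζ(3)` (the double shuffle and duality relations of weight `7`). [cite: ChmutovDuzhinMostovoy2012, §10.2.6] -/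
theorem multipleZeta_four_two_one_eq :
    multipleZeta [4, 2, 1] = -(221 / 16 * multipleZeta [7]) + 11 / 12 * (Real.pi ^ 2 * multipleZeta [5]) + 7 / 180 * (Real.pi ^ 4 * multipleZeta [3]) := by
  rw [← multipleZeta_three_two_one_one_eq_four_two_one_dual]
  exact multipleZeta_three_two_one_one_eq

/-- `ζ(4,3) = 17ζ(7) - 10ζ(2)ζ(5)` (the double shuffle and duality relations of weight `7`). [cite: ChmutovDuzhinMostovoy2012, §10.2.6] -/
theorem multipleZeta_four_three_eq :
    multipleZeta [4, 3] = 17 * multipleZeta [7] - 5 / 3 * (Real.pi ^ 2 * multipleZeta [5]) := by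
  rw [← multipleZeta_two_one_two_one_one_eq_four_three_dual]
  exact multipleZeta_two_one_two_one_one_eq

/-- `ζ(5,1,1) = 5 * ζ(7) - 1 / 3 * π²ζ(5) - 1 / 72 * π⁴ζ(3)` (the double shuffle and duality relations of weight `7`). [cite: ChmutovDuzhinMostovoy2012, §10.2.6] -/
theorem multipleZeta_five_one_one_eq :
    multipleZeta [5, 1, 1] = 5 * multipleZeta [7] - 1 / 3 * (Real.pi ^ 2 * multipleZeta [5]) - 1 / 72 * (Real.pi ^ 4 * multipleZeta [3]) := by
  rw [← multipleZeta_four_one_one_one_eq_five_one_one_dual]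
  exact multipleZeta_four_one_one_one_eq

/-- `ζ(5,2) = -11ζ(7) + 5ζ(2)ζ(5) + 2ζ(3)ζ(4)` (the double shuffle and duality relations of weight `7`). [cite: ChmutovDuzhinMostovoy2012, §10.2.6] -/
theorem multipleZeta_five_two_eq :
    multipleZeta [5, 2] = -(11 * multipleZeta [7]) + 5 / 6 * (Real.pi ^ 2 * multipleZeta [5]) + 1 / 45 * (Real.pi ^ 4 * multipleZeta [3]) := by
  rw [← multipleZeta_two_two_one_one_one_eq_five_two_dual]
  exact multipleZeta_two_two_one_one_one_eq

/-- Euler's `ζ(6,1) = 3ζ(7) - ζ(2)ζ(5) - ζ(3)ζ(4)` (Eie 2013, §0.1, `S_{1,6}`) (the double shuffle and duality relations of weight `7`). [cite: ChmutovDuzhinMostovoy2012, §10.2.6] -/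
theorem multipleZeta_six_one_eq :
    multipleZeta [6, 1] = 3 * multipleZeta [7] - 1 / 6 * (Real.pi ^ 2 * multipleZeta [5]) - 1 / 90 * (Real.pi ^ 4 * multipleZeta [3]) := by
  rw [← multipleZeta_three_one_one_one_one_eq_six_one_dual]
  exact multipleZeta_three_one_one_one_one_eq

/-! ### The admissible indices of weight `7` -/

/-- The thirty-two admissible indices of weight `7` (compositions of `7` with first part `≥ 2`).
[folklore] -/
theorem MZV.eq_of_isAdmissible_of_weight_eq_seven {s : List ℕ} (hs : MZV.IsAdmissible s)
    (hw : MZV.weight s = 7) :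

    s = [2, 1, 1, 1, 1, 1] ∨ s = [2, 1, 1, 1, 2] ∨ s = [2, 1, 1, 2, 1] ∨ s = [2, 1, 1, 3] ∨
      s = [2, 1, 2, 1, 1] ∨ s = [2, 1, 2, 2] ∨ s = [2, 1, 3, 1] ∨ s = [2, 1, 4] ∨
      s = [2, 2, 1, 1, 1] ∨ s = [2, 2, 1, 2] ∨ s = [2, 2, 2, 1] ∨ s = [2, 2, 3] ∨
      s = [2, 3, 1, 1] ∨ s = [2, 3, 2] ∨ s = [2, 4, 1] ∨ s = [2, 5] ∨
      s = [3, 1, 1, 1, 1] ∨ s = [3, 1, 1, 2] ∨ s = [3, 1, 2, 1] ∨ s = [3, 1, 3] ∨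
      s = [3, 2, 1, 1] ∨ s = [3, 2, 2] ∨ s = [3, 3, 1] ∨ s = [3, 4] ∨
      s = [4, 1, 1, 1] ∨ s = [4, 1, 2] ∨ s = [4, 2, 1] ∨ s = [4, 3] ∨
      s = [5, 1, 1] ∨ s = [5, 2] ∨ s = [6, 1] ∨ s = [7] := by
  match s, hs, hw with
  | [], _, hw => simp [MZV.weight] at hw
  | [a], hs, hw =>
    have ha : 2 ≤ a := by simpa using hs.2 (by simp)
    simp only [MZV.weight, List.sum_cons, List.sum_nil, Nat.add_zero] at hw
    obtain rfl : a = 7 := by omega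
    decide
  | [a, b], hs, hw =>
    have ha : 2 ≤ a := by simpa using hs.2 (by simp)
    have hb : 1 ≤ b := hs.1 b (by simp)
    simp only [MZV.weight, List.sum_cons, List.sum_nil, Nat.add_zero] at hw
    have hau : a ≤ 6 := by omega
    have hbu : b ≤ 5 := by omega
    interval_cases a <;> interval_cases b <;> first | decide | omega
  | [a, b, c], hs, hw =>
    have ha : 2 ≤ a := by simpa using hs.2 (by simp)
    have hb : 1 ≤ b := hs.1 b (by simp)
    have hc : 1 ≤ c := hs.1 c (by simp)
    simp only [MZV.weight, List.sum_cons, List.sum_nil, Nat.add_zero] at hw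
    have hau : a ≤ 5 := by omega
    have hbu : b ≤ 4 := by omega
    have hcu : c ≤ 4 := by omega
    interval_cases a <;> interval_cases b <;> interval_cases c <;> first | decide | omega
  | [a, b, c, d], hs, hw =>
    have ha : 2 ≤ a := by simpa using hs.2 (by simp)
    have hb : 1 ≤ b := hs.1 b (by simp)
    have hc : 1 ≤ c := hs.1 c (by simp)
    have hd : 1 ≤ d := hs.1 d (by simp)
    simp only [MZV.weight, List.sum_cons, List.sum_nil, Nat.add_zero] at hw
    have hau : a ≤ 4 := by omega
    have hbu : b ≤ 3 := by omega
    have hcu : c ≤ 3 := by omega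
    have hdu : d ≤ 3 := by omega
    interval_cases a <;> interval_cases b <;> interval_cases c <;> interval_cases d <;> first | decide | omega
  | [a, b, c, d, e], hs, hw =>
    have ha : 2 ≤ a := by simpa using hs.2 (by simp)
    have hb : 1 ≤ b := hs.1 b (by simp)
    have hc : 1 ≤ c := hs.1 c (by simp)
    have hd : 1 ≤ d := hs.1 d (by simp)
    have he : 1 ≤ e := hs.1 e (by simp)
    simp only [MZV.weight, List.sum_cons, List.sum_nil, Nat.add_zero] at hw
    have hau : a ≤ 3 := by omega
    have hbu : b ≤ 2 := by omega
    have hcu : c ≤ 2 := by omega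
    have hdu : d ≤ 2 := by omega
    have heu : e ≤ 2 := by omega
    interval_cases a <;> interval_cases b <;> interval_cases c <;> interval_cases d <;> interval_cases e <;> first | decide | omega
  | [a, b, c, d, e, f], hs, hw =>
    have ha : 2 ≤ a := by simpa using hs.2 (by simp)
    have hb : 1 ≤ b := hs.1 b (by simp)
    have hc : 1 ≤ c := hs.1 c (by simp)
    have hd : 1 ≤ d := hs.1 d (by simp)
    have he : 1 ≤ e := hs.1 e (by simp)
    have hf : 1 ≤ f := hs.1 f (by simp)
    simp only [MZV.weight, List.sum_cons, List.sum_nil, Nat.add_zero] at hw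
    obtain rfl : a = 2 := by omega
    obtain rfl : b = 1 := by omega
    obtain rfl : c = 1 := by omega
    obtain rfl : d = 1 := by omega
    obtain rfl : e = 1 := by omega
    obtain rfl : f = 1 := by omega
    decide
  | a :: b :: c :: d :: e :: f :: g :: t, hs, hw =>
    exfalso
    have ha : 2 ≤ a := by simpa using hs.2 (by simp)
    have hb : 1 ≤ b := hs.1 b (by simp)
    have hc : 1 ≤ c := hs.1 c (by simp)
    have hd : 1 ≤ d := hs.1 d (by simp)
    have he : 1 ≤ e := hs.1 e (by simp)
    have hf : 1 ≤ f := hs.1 f (by simp)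
    have hg : 1 ≤ g := hs.1 g (by simp)
    simp only [MZV.weight, List.sum_cons] at hw
    omega

/-! ### The weight space `𝒵₇` -/

/-- A real number `a u + b v + c w` with `a, b, c ∈ ℚ` lies in the `ℚ`-span of `{u, v, w}`.
[folklore] -/
theorem mem_span_triple_of_eq_rat_mul_add {x u v w : ℝ} (a b c : ℚ)
    (h : x = a * u + b * v + c * w) : x ∈ Submodule.span ℚ {u, v, w} :=
  Submodule.mem_span_triple.2 ⟨a, b, c, by rw [h, Rat.smul_def, Rat.smul_def, Rat.smul_def]⟩

/-- Every multiple zeta value of weight `7` is a rational linear combination of `ζ(7)`, `π²ζ(5)`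
and `π⁴ζ(3)` (Chmutov–Duzhin–Mostovoy 2012, §10.2.6; the table above).
[cite: ChmutovDuzhinMostovoy2012, §10.2.6] -/
theorem multipleZeta_mem_span_of_weight_seven {s : List ℕ} (hs : MZV.IsAdmissible s)
    (hw : MZV.weight s = 7) :
    multipleZeta s ∈ Submodule.span ℚ
      {multipleZeta [7], Real.pi ^ 2 * multipleZeta [5], Real.pi ^ 4 * multipleZeta [3]} := by
  rcases MZV.eq_of_isAdmissible_of_weight_eq_seven hs hw with
    rfl | rfl | rfl | rfl | rfl | rfl | rfl | rfl | rfl | rfl | rfl | rfl | rfl | rfl | rfl | rfl | rfl | rfl | rfl | rfl | rfl | rfl | rfl | rfl | rfl | rfl | rfl | rfl | rfl | rfl | rfl | rfl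

  · exact mem_span_triple_of_eq_rat_mul_add (1) (0) (0)
      (by rw [multipleZeta_two_one_one_one_one_one_eq]; push_cast; ring)
  · exact mem_span_triple_of_eq_rat_mul_add (10) (-2 / 3) (-1 / 45)
      (by rw [multipleZeta_two_one_one_one_two_eq]; push_cast; ring)
  · exact mem_span_triple_of_eq_rat_mul_add (-18) (5 / 3) (1 / 90)
      (by rw [multipleZeta_two_one_one_two_one_eq]; push_cast; ring)
  · exact mem_span_triple_of_eq_rat_mul_add (61 / 8) (-11 / 12) (7 / 360)
      (by rw [multipleZeta_two_one_one_three_eq]; push_cast; ring)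
  · exact mem_span_triple_of_eq_rat_mul_add (17) (-5 / 3) (0)
      (by rw [multipleZeta_two_one_two_one_one_eq]; push_cast; ring)
  · exact mem_span_triple_of_eq_rat_mul_add (-291 / 16) (2) (-1 / 60)
      (by rw [multipleZeta_two_one_two_two_eq]; push_cast; ring)
  · exact mem_span_triple_of_eq_rat_mul_add (-1 / 4) (0) (1 / 360)
      (by rw [multipleZeta_two_one_three_one_eq]; push_cast; ring)
  · exact mem_span_triple_of_eq_rat_mul_add (61 / 8) (-11 / 12) (7 / 360)
      (by rw [multipleZeta_two_one_four_eq]; push_cast; ring)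
  · exact mem_span_triple_of_eq_rat_mul_add (-11) (5 / 6) (1 / 45)
      (by rw [multipleZeta_two_two_one_one_one_eq]; push_cast; ring)
  · exact mem_span_triple_of_eq_rat_mul_add (75 / 8) (-11 / 12) (0)
      (by rw [multipleZeta_two_two_one_two_eq]; push_cast; ring)
  · exact mem_span_triple_of_eq_rat_mul_add (157 / 16) (-5 / 4) (1 / 40)
      (by rw [multipleZeta_two_two_two_one_eq]; push_cast; ring)
  · exact mem_span_triple_of_eq_rat_mul_add (-291 / 16) (2) (-1 / 60)
      (by rw [multipleZeta_two_two_three_eq]; push_cast; ring)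
  · exact mem_span_triple_of_eq_rat_mul_add (5 / 8) (5 / 12) (-1 / 24)
      (by rw [multipleZeta_two_three_one_one_eq]; push_cast; ring)
  · exact mem_span_triple_of_eq_rat_mul_add (75 / 8) (-11 / 12) (0)
      (by rw [multipleZeta_two_three_two_eq]; push_cast; ring)
  · exact mem_span_triple_of_eq_rat_mul_add (-109 / 16) (5 / 6) (-1 / 72)
      (by rw [multipleZeta_two_four_one_eq]; push_cast; ring)
  · exact mem_span_triple_of_eq_rat_mul_add (10) (-2 / 3) (-1 / 45)
      (by rw [multipleZeta_two_five_eq]; push_cast; ring)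
  · exact mem_span_triple_of_eq_rat_mul_add (3) (-1 / 6) (-1 / 90)
      (by rw [multipleZeta_three_one_one_one_one_eq]; push_cast; ring)
  · exact mem_span_triple_of_eq_rat_mul_add (-109 / 16) (5 / 6) (-1 / 72)
      (by rw [multipleZeta_three_one_one_two_eq]; push_cast; ring)
  · exact mem_span_triple_of_eq_rat_mul_add (61 / 8) (-3 / 4) (0)
      (by rw [multipleZeta_three_one_two_one_eq]; push_cast; ring)
  · exact mem_span_triple_of_eq_rat_mul_add (-1 / 4) (0) (1 / 360)
      (by rw [multipleZeta_three_one_three_eq]; push_cast; ring)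
  · exact mem_span_triple_of_eq_rat_mul_add (-221 / 16) (11 / 12) (7 / 180)
      (by rw [multipleZeta_three_two_one_one_eq]; push_cast; ring)
  · exact mem_span_triple_of_eq_rat_mul_add (157 / 16) (-5 / 4) (1 / 40)
      (by rw [multipleZeta_three_two_two_eq]; push_cast; ring)
  · exact mem_span_triple_of_eq_rat_mul_add (61 / 8) (-3 / 4) (0)
      (by rw [multipleZeta_three_three_one_eq]; push_cast; ring)
  · exact mem_span_triple_of_eq_rat_mul_add (-18) (5 / 3) (1 / 90)
      (by rw [multipleZeta_three_four_eq]; push_cast; ring)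
  · exact mem_span_triple_of_eq_rat_mul_add (5) (-1 / 3) (-1 / 72)
      (by rw [multipleZeta_four_one_one_one_eq]; push_cast; ring)
  · exact mem_span_triple_of_eq_rat_mul_add (5 / 8) (5 / 12) (-1 / 24)
      (by rw [multipleZeta_four_one_two_eq]; push_cast; ring)
  · exact mem_span_triple_of_eq_rat_mul_add (-221 / 16) (11 / 12) (7 / 180)
      (by rw [multipleZeta_four_two_one_eq]; push_cast; ring)
  · exact mem_span_triple_of_eq_rat_mul_add (17) (-5 / 3) (0)
      (by rw [multipleZeta_four_three_eq]; push_cast; ring)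
  · exact mem_span_triple_of_eq_rat_mul_add (5) (-1 / 3) (-1 / 72)
      (by rw [multipleZeta_five_one_one_eq]; push_cast; ring)
  · exact mem_span_triple_of_eq_rat_mul_add (-11) (5 / 6) (1 / 45)
      (by rw [multipleZeta_five_two_eq]; push_cast; ring)
  · exact mem_span_triple_of_eq_rat_mul_add (3) (-1 / 6) (-1 / 90)
      (by rw [multipleZeta_six_one_eq]; push_cast; ring)
  · exact mem_span_triple_of_eq_rat_mul_add 1 0 0 (by push_cast; ring)

/-- **Hoffman's conjecture in weight `7`**: every multiple zeta value of weight `7` is a rational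
linear combination of the three Hoffman elements `ζ(3,2,2)`, `ζ(2,3,2)`, `ζ(2,2,3)` (Brown 2012,
Theorem 1.1 in weight `7`; the change of basis from `ζ(7), π²ζ(5), π⁴ζ(3)` is invertible).
[cite: ChmutovDuzhinMostovoy2012, §10.2.6] -/
theorem multipleZeta_mem_span_hoffman_of_weight_seven {s : List ℕ} (hs : MZV.IsAdmissible s)
    (hw : MZV.weight s = 7) :
    multipleZeta s ∈ Submodule.span ℚ
      {multipleZeta [3, 2, 2], multipleZeta [2, 3, 2], multipleZeta [2, 2, 3]} := by
  have h322 := multipleZeta_three_two_two_eq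
  have h232 := multipleZeta_two_three_two_eq
  have h223 := multipleZeta_two_two_three_eq
  rcases MZV.eq_of_isAdmissible_of_weight_eq_seven hs hw with
    rfl | rfl | rfl | rfl | rfl | rfl | rfl | rfl | rfl | rfl | rfl | rfl | rfl | rfl | rfl | rfl | rfl | rfl | rfl | rfl | rfl | rfl | rfl | rfl | rfl | rfl | rfl | rfl | rfl | rfl | rfl | rfl

  · exact mem_span_triple_of_eq_rat_mul_add (352 / 151) (672 / 151) (528 / 151)
      (by rw [multipleZeta_two_one_one_one_one_one_eq]; push_cast; linarith)
  · exact mem_span_triple_of_eq_rat_mul_add (56 / 151) (656 / 151) (856 / 453)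
      (by rw [multipleZeta_two_one_one_one_two_eq]; push_cast; linarith)
  · exact mem_span_triple_of_eq_rat_mul_add (196 / 151) (-120 / 151) (580 / 453)
      (by rw [multipleZeta_two_one_one_two_one_eq]; push_cast; linarith)
  · exact mem_span_triple_of_eq_rat_mul_add (315 / 151) (368 / 151) (889 / 453)
      (by rw [multipleZeta_two_one_one_three_eq]; push_cast; linarith)
  · exact mem_span_triple_of_eq_rat_mul_add (-16 / 151) (244 / 151) (-24 / 151)
      (by rw [multipleZeta_two_one_two_one_one_eq]; push_cast; linarith)
  · exact mem_span_triple_of_eq_rat_mul_add (0) (0) (1)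
      (by rw [multipleZeta_two_one_two_two_eq]; push_cast; linarith)
  · exact mem_span_triple_of_eq_rat_mul_add (45 / 151) (31 / 151) (127 / 453)
      (by rw [multipleZeta_two_one_three_one_eq]; push_cast; linarith)
  · exact mem_span_triple_of_eq_rat_mul_add (315 / 151) (368 / 151) (889 / 453)
      (by rw [multipleZeta_two_one_four_eq]; push_cast; linarith)
  · exact mem_span_triple_of_eq_rat_mul_add (192 / 151) (-210 / 151) (260 / 453)
      (by rw [multipleZeta_two_two_one_one_one_eq]; push_cast; linarith)
  · exact mem_span_triple_of_eq_rat_mul_add (0) (1) (0)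
      (by rw [multipleZeta_two_two_one_two_eq]; push_cast; linarith)
  · exact mem_span_triple_of_eq_rat_mul_add (1) (0) (0)
      (by rw [multipleZeta_two_two_two_one_eq]; push_cast; linarith)
  · exact mem_span_triple_of_eq_rat_mul_add (0) (0) (1) (by push_cast; ring)
  · exact mem_span_triple_of_eq_rat_mul_add (-275 / 151) (230 / 151) (-35 / 151)
      (by rw [multipleZeta_two_three_one_one_eq]; push_cast; linarith)
  · exact mem_span_triple_of_eq_rat_mul_add (0) (1) (0) (by push_cast; ring)
  · exact mem_span_triple_of_eq_rat_mul_add (-63 / 151) (17 / 151) (94 / 453)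
      (by rw [multipleZeta_two_four_one_eq]; push_cast; linarith)
  · exact mem_span_triple_of_eq_rat_mul_add (56 / 151) (656 / 151) (856 / 453)
      (by rw [multipleZeta_two_five_eq]; push_cast; linarith)
  · exact mem_span_triple_of_eq_rat_mul_add (-76 / 151) (102 / 151) (-40 / 453)
      (by rw [multipleZeta_three_one_one_one_one_eq]; push_cast; linarith)
  · exact mem_span_triple_of_eq_rat_mul_add (-63 / 151) (17 / 151) (94 / 453)
      (by rw [multipleZeta_three_one_one_two_eq]; push_cast; linarith)
  · exact mem_span_triple_of_eq_rat_mul_add (-16 / 151) (93 / 151) (-24 / 151)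
      (by rw [multipleZeta_three_one_two_one_eq]; push_cast; linarith)
  · exact mem_span_triple_of_eq_rat_mul_add (45 / 151) (31 / 151) (127 / 453)
      (by rw [multipleZeta_three_one_three_eq]; push_cast; linarith)
  · exact mem_span_triple_of_eq_rat_mul_add (300 / 151) (-347 / 151) (293 / 453)
      (by rw [multipleZeta_three_two_one_one_eq]; push_cast; linarith)
  · exact mem_span_triple_of_eq_rat_mul_add (1) (0) (0) (by push_cast; ring)
  · exact mem_span_triple_of_eq_rat_mul_add (-16 / 151) (93 / 151) (-24 / 151)
      (by rw [multipleZeta_three_three_one_eq]; push_cast; linarith)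
  · exact mem_span_triple_of_eq_rat_mul_add (196 / 151) (-120 / 151) (580 / 453)
      (by rw [multipleZeta_three_four_eq]; push_cast; linarith)
  · exact mem_span_triple_of_eq_rat_mul_add (-105 / 151) (129 / 151) (-95 / 453)
      (by rw [multipleZeta_four_one_one_one_eq]; push_cast; linarith)
  · exact mem_span_triple_of_eq_rat_mul_add (-275 / 151) (230 / 151) (-35 / 151)
      (by rw [multipleZeta_four_one_two_eq]; push_cast; linarith)
  · exact mem_span_triple_of_eq_rat_mul_add (300 / 151) (-347 / 151) (293 / 453)
      (by rw [multipleZeta_four_two_one_eq]; push_cast; linarith)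
  · exact mem_span_triple_of_eq_rat_mul_add (-16 / 151) (244 / 151) (-24 / 151)
      (by rw [multipleZeta_four_three_eq]; push_cast; linarith)
  · exact mem_span_triple_of_eq_rat_mul_add (-105 / 151) (129 / 151) (-95 / 453)
      (by rw [multipleZeta_five_one_one_eq]; push_cast; linarith)
  · exact mem_span_triple_of_eq_rat_mul_add (192 / 151) (-210 / 151) (260 / 453)
      (by rw [multipleZeta_five_two_eq]; push_cast; linarith)
  · exact mem_span_triple_of_eq_rat_mul_add (-76 / 151) (102 / 151) (-40 / 453)
      (by rw [multipleZeta_six_one_eq]; push_cast; linarith)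
  · exact mem_span_triple_of_eq_rat_mul_add (352 / 151) (672 / 151) (528 / 151)
      (by push_cast; linarith)

/-- `π²ζ(5) = 6 ζ(2)ζ(5) = 6(ζ(2,5) + ζ(5,2) + ζ(7)) ∈ 𝒵₇`. [cite: Hoffman1997, Theorem 4.2] -/
theorem pi_sq_mul_multipleZeta_five_mem_mzvSpace_seven :
    Real.pi ^ 2 * multipleZeta [5] ∈ mzvSpace 7 := by
  have h : Real.pi ^ 2 * multipleZeta [5] = (6 : ℚ) • (multipleZeta [2] * multipleZeta [5]) := by
    rw [multipleZeta_two, Rat.smul_def]; push_cast; ring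
  rw [h]
  refine Submodule.smul_mem _ _ ?_
  have h2 : multipleZeta [2] ∈ mzvSpace 2 := Submodule.subset_span ⟨[2], by decide, rfl, rfl⟩
  have h5 : multipleZeta [5] ∈ mzvSpace 5 := Submodule.subset_span ⟨[5], by decide, rfl, rfl⟩
  exact mem_mzvSpace_mul_holds (a := 2) (b := 5) h2 h5

/-- `π⁴ζ(3) = 90 ζ(4)ζ(3) ∈ 𝒵₇`. [cite: Hoffman1997, Theorem 4.2] -/
theorem pi_pow_four_mul_multipleZeta_three_mem_mzvSpace_seven :
    Real.pi ^ 4 * multipleZeta [3] ∈ mzvSpace 7 := by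
  have h : Real.pi ^ 4 * multipleZeta [3] = (90 : ℚ) • (multipleZeta [4] * multipleZeta [3]) := by
    rw [multipleZeta_four, Rat.smul_def]; push_cast; ring
  rw [h]
  refine Submodule.smul_mem _ _ ?_
  have h4 : multipleZeta [4] ∈ mzvSpace 4 := Submodule.subset_span ⟨[4], by decide, rfl, rfl⟩
  have h3 : multipleZeta [3] ∈ mzvSpace 3 := Submodule.subset_span ⟨[3], by decide, rfl, rfl⟩
  exact mem_mzvSpace_mul_holds (a := 4) (b := 3) h4 h3

/-- **`𝒵₇ = ℚ ζ(7) + ℚ π²ζ(5) + ℚ π⁴ζ(3)`** (Chmutov–Duzhin–Mostovoy 2012, §10.2.6: in weight `7` the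
monomials in `ζ(2), ζ(3), ζ(5), ζ(7), …` are `ζ(7)`, `ζ(2)ζ(5)`, `ζ(2)²ζ(3)`).
[cite: ChmutovDuzhinMostovoy2012, §10.2.6] -/
theorem mzvSpace_seven_eq_span :
    mzvSpace 7 = Submodule.span ℚ
      {multipleZeta [7], Real.pi ^ 2 * multipleZeta [5], Real.pi ^ 4 * multipleZeta [3]} := by
  apply le_antisymm
  · rw [mzvSpace, Submodule.span_le]
    rintro x ⟨s, hs, hw, rfl⟩
    exact multipleZeta_mem_span_of_weight_seven hs hw
  · rw [Submodule.span_le]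
    rintro x hx
    rcases hx with rfl | rfl | rfl
    · exact Submodule.subset_span ⟨[7], by decide, rfl, rfl⟩
    · exact pi_sq_mul_multipleZeta_five_mem_mzvSpace_seven
    · exact pi_pow_four_mul_multipleZeta_three_mem_mzvSpace_seven

/-- **`𝒵₇ = ℚ ζ(3,2,2) + ℚ ζ(2,3,2) + ℚ ζ(2,2,3)`**: the weight-`7` multiple zeta values span exactly
the `ℚ`-span of the three Hoffman elements of weight `7` (Hoffman's conjecture / Brown's theorem
in weight `7`, here from the finite double shuffle relations and duality).
[cite: ChmutovDuzhinMostovoy2012, §10.2.6] -/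
theorem mzvSpace_seven_eq_span_hoffman :
    mzvSpace 7 = Submodule.span ℚ
      {multipleZeta [3, 2, 2], multipleZeta [2, 3, 2], multipleZeta [2, 2, 3]} := by
  apply le_antisymm
  · rw [mzvSpace, Submodule.span_le]
    rintro x ⟨s, hs, hw, rfl⟩
    exact multipleZeta_mem_span_hoffman_of_weight_seven hs hw
  · rw [Submodule.span_le]
    rintro x hx
    rcases hx with rfl | rfl | rfl
    · exact Submodule.subset_span ⟨[3, 2, 2], by decide, rfl, rfl⟩
    · exact Submodule.subset_span ⟨[2, 3, 2], by decide, rfl, rfl⟩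
    · exact Submodule.subset_span ⟨[2, 2, 3], by decide, rfl, rfl⟩

/-- **`dim_ℚ 𝒵₇ ≤ 3 = d₇`**: the Goncharov–Terasoma / Deligne–Goncharov bound `dim_ℚ 𝒵_n ≤ d_n`
(named fact `finrank_mzvSpace_le_zagierDim`) in weight `7`, unconditionally. Equality would be the
`ℚ`-linear independence of `ζ(7)`, `π²ζ(5)`, `π⁴ζ(3)`, which is open.
[cite: ChmutovDuzhinMostovoy2012, §10.2.6] -/
theorem finrank_mzvSpace_seven_le : Module.finrank ℚ (mzvSpace 7) ≤ 3 := by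
  rw [mzvSpace_seven_eq_span,
    show ({multipleZeta [7], Real.pi ^ 2 * multipleZeta [5], Real.pi ^ 4 * multipleZeta [3]} : Set ℝ) =
      (({multipleZeta [7], Real.pi ^ 2 * multipleZeta [5], Real.pi ^ 4 * multipleZeta [3]} :
        Finset ℝ) : Set ℝ) by simp]
  exact (finrank_span_finset_le_card _).trans Finset.card_le_three

/-- `dim_ℚ 𝒵₇ ≤ d₇` (`d₇ = 3`). [cite: ChmutovDuzhinMostovoy2012, §10.2.6] -/
theorem finrank_mzvSpace_seven_le_zagierDim : Module.finrank ℚ (mzvSpace 7) ≤ zagierDim 7 :=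
  finrank_mzvSpace_seven_le

end Literature.NumberTheory.Transcendental
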